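import Literature.Analysis.Approximation.CarberyWright
import Mathlib.Algebra.BigOperators.Intervals
import Mathlib.Analysis.Convex.Basic
import Mathlib.Analysis.SpecialFunctions.Pow.Real
import Mathlib.Data.Nat.Choose.Cast
import Mathlib.Data.Nat.Choose.Sum
import Mathlib.Data.Nat.Factorial.BigOperators
import Mathlib.LinearAlgebra.Lagrange
import Mathlib.MeasureTheory.Constructions.HaarToSphere
import Mathlib.MeasureTheory.Measure.Lebesgue.EqHaar
import Mathlib.RingTheory.Polynomial.Basic
import Mathlib.Topology.Algebra.MvPolynomial
import Mathlib.Topology.Order.Compact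
import Mathlib.Analysis.Analytic.Polynomial
import Mathlib.Analysis.Complex.Polynomial.Basic
import Mathlib.Analysis.SpecialFunctions.BinaryEntropy
import Mathlib.Analysis.SpecialFunctions.Integrability.LogMeromorphic
import Mathlib.FieldTheory.IsAlgClosed.Basic
import Mathlib.MeasureTheory.Function.JacobianOneDim
import HarnessLib

/-!
# Carbery–Wright: proofs of `supSublevelBound` and `supLeGeometricMean`

(Theorem 2 at `q = ∞`, Part 1; Theorem 1 at `r = 0`, `q = ∞`, Part 2.)

This file DISCHARGES the named fact
`Literature.Analysis.Approximation.CarberyWright.supSublevelBound` (A. Carbery, J. Wright,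
*Distributional and `L^q` norm inequalities for polynomials over convex bodies in `ℝⁿ`*,
Math. Res. Lett. 8 (2001) 233–248 [CarberyWright2001], Theorem 2 at `q = ∞`, scalar case; the
paper credits this case to Brudnyi–Ganzburg, Izv. Akad. Nauk SSSR 37 (1973) [BG], p. 235):
`theorem CarberyWright.supSublevelBound_holds : CarberyWright.supSublevelBound`, with the absolute
constant `C = 16 e²`.

## The printed proof and the road taken here

Carbery–Wright prove Theorem 2 by reducing it, through the localization lemma of
Kannan–Lovász–Simonovits (p. 235), to the one-dimensional weighted Theorem 4, whose case `q = ∞`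
is (p. 241) an immediate consequence of

* Lemma 4 (p. 240): for a polynomial `p` of degree `≤ d` on an interval `I`,
  `‖p‖_{L^∞(I)}^{1/d} α^{-1/d} |{x ∈ I : |p(x)| ≤ α}| ≤ C |I|` — a one-dimensional Remez-type
  (sublevel-set) inequality, and
* the observation `(λ - t)^{n-1} ≤ n ∫₀¹ (λ - s)^{n-1} ds` (`0 ≤ t ≤ 1 ≤ λ`): on a needle the
  weight is at most `n` times its average.

We formalize exactly these two ingredients, but we replace the (heavy) KLS localization lemma by the
elementary ray decomposition of Brudnyi–Ganzburg, which is what KLS abstracts in this instance: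
decompose Lebesgue measure in polar coordinates about a point `x₀ ∈ K` where `|p|` attains its
maximum `M` (Mathlib's `Measure.toSphere` / `Measure.volumeIoiPow`,
`measurePreserving_homeomorphUnitSphereProd`; on `Fin n → ℝ` Mathlib's norm is the sup norm, so
"directions" live on the boundary of the unit cube — the argument is norm-independent). On the
chord of `K` in direction `θ`, of length
`L(θ)`, the radial weight `r^{n-1}` is at most `L^{n-1} = n · (average of r^{n-1} over [0, L])`, so
if on EVERY chord the linear measure of the sublevel set `ω = {x ∈ K : |p| ≤ α^d}` were
`≤ κ L(θ)`, integrating over directions would give `|ω| ≤ n κ |K| = n κ`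
(`measure_le_of_raySlice_bound`). Hence for every `κ` with `nκ < |ω|` some chord carries a
portion of `ω` of relative length `> κ`, and on that chord Lemma 4 — here in the Remez form
`sup_I |q| ≤ e (8e|I|/|S|)^d sup_S |q|` (`remez_weak`, proved by Lagrange interpolation at `d + 1`
nodes of `S` with mutual gaps `≥ |S|/(4(d+1))`, instead of the paper's route through Cartan's lemma)
— applied to `q(r) = p(x₀ + rθ)` at the point `r = 0` where `|q| = M` gives
`M ≤ e (8e/κ)^d α^d`. With `κ = 16e² α / M^{1/d}` this reads `M ≤ M e/(2e)^d ≤ M/2`, a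
contradiction; so `|ω| ≤ 16 e² n α / M^{1/d}`, which is the claim.

Constants are not optimised (the sharp one-dimensional constant is `4`, Dudley–Randol; the printed
multivariate constant is `C n` with `C` absolute, which is what is proved).

## Contents

* `exists_separated_points`, `abs_eval_le_of_nodes`, `remez_weak` — the one-dimensional step.
* `exists_linePoly` — the restriction of an `MvPolynomial` to a line is a polynomial of no larger
  degree.
* `measure_eq_lintegral_volumeIoiPow`, `measure_eq_lintegral_raySlice`,
  `measure_le_of_raySlice_bound`, `exists_rayLength` — polar slicing about a base point.
* `supSublevelBound_holds` — the assembly.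

No definitions and no named facts are introduced (theorems only).  The companion fact
`CarberyWright.supLeGeometricMean` (Theorem 1 at `r = 0`, `q = ∞`) is discharged in PART 2 of this
file (sections `GeometricMeanOneDim`, `GeometricMeanAssembly`, appended 2026-08-15), as follows.

## Part 2 — Theorem 1 at `r = 0`, `q = ∞` (discharges `supLeGeometricMean`)

Part 2 discharges the named fact
`Literature.Analysis.Approximation.CarberyWright.supLeGeometricMean` of
`Literature/Analysis/Approximation/CarberyWright.lean`
(`CarberyWright.supLeGeometricMean_holds`, at the end): there is an absolute constant `C > 0`
(we obtain `C = 2e`) such that for `n, d ≥ 1`, every real polynomial `p` of degree `≤ d` on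
`ℝⁿ` and every convex body `K ⊂ ℝⁿ` of volume `1` with `M := sup_K |p| > 0`, `log |p|` is
integrable on `K` and `M^{1/d} ≤ C · n · exp((1/d) ∫_K log |p|)`
[A. Carbery, J. Wright, Math. Res. Lett. 8 (2001) 233–248, Theorem 1 with `r = 0`, `q = ∞`;
the scalar case `q = ∞` is credited there to Brudnyi–Ganzburg 1973].

### The argument formalised in Part 2

The paper (§2, p. 235) reduces Theorem 1 to a weighted one-dimensional inequality (its
Theorem 3) through the Kannan–Lovász–Simonovits localisation lemma, and proves the
one-dimensional Remez-type Lemma 1 (pp. 236–237) by FACTORISING the polynomial over its complex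
roots and bounding the contribution of each root factor to `∫ log |p|`.  We keep the Lemma-1
mechanism (root factorisation, one root at a time) but replace the KLS localisation — a major
theorem not available in Mathlib — by the classical Brudnyi–Ganzburg cone argument, which is the
genuinely shorter road for this endpoint: polar coordinates centred at a maximum point `x₀ ∈ K`
of `|p|` (Mathlib's `measurePreserving_homeomorphUnitSphereProd`, valid for any norm, here the
sup norm of `Fin n → ℝ`).  Along each ray `x₀ + rθ`, `0 < r ≤ ρ(θ)` (an interval, by
convexity),
`q(r) = p(x₀ + rθ)` is a real polynomial of degree `≤ d` with `|q(0)| = M`, and the weighted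
one-dimensional lemma
`n ∫₀^ρ r^{n-1} (log M - log |q(r)|) dr ≤ d · (log 2 + 1 + log n) · ρⁿ`
(`ray_bound`, from `poly_bound`: factor `q` over `ℂ`, each root `ζ ≠ 0` contributes
`n ∫₀¹ s^{n-1} log |1 - s/ζ| ds ≥ -(log 2 + 1 + log n)` by comparison with the kernel
`n ∫₀¹ s^{n-1} log |s - a| ds ≥ -(log 2 + 1 + log n)`, `a ∈ [0,1]`, itself obtained from
`|sⁿ - aⁿ| ≤ n |s - a|`, the substitution `u = sⁿ` and
`∫₀¹ log |u - b| du ≥ -log 2 - 1`)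
integrates over the sphere to `∫_K (log M - log |p|) ≤ d (log 2 + 1 + log n) · vol K`, whence
`M^{1/d} ≤ 2 e n · exp((1/d) ∫_K log |p|)`.

Part-2 lemmas: `lintegral_eq_lintegral_sphere_Ioi` (public: the polar-coordinate formula for
`∫⁻` of a measurable function, any finite-dimensional real normed space) and the `private`
`integral_log_abs_sub`, `entropy_bound`, `kernel_bound`, `normSq_real_sub`,
`root_factor_integrable`, `root_factor_bound`, `multiset_root_bound`, `poly_bound`, `c_nonneg`,
`poly_bound_scaled`, `intervalIntegrable_log_abs_poly`, `ray_bound`, `main_lintegral_bound`;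
Part 2 reuses `exists_linePoly` of Part 1.  Part 2 introduces no definitions and no named facts.
-/

open MeasureTheory Set

namespace Literature.Analysis.Approximation.CarberyWright

section OneDim

open Finset Polynomial
open scoped Nat
/-- Greedy selection of `m` points of `S` to the right of `a`, with mutual gaps `≥ h`, from
`volume (S ∩ [a, ∞)) > 2hm` (outer measure; no measurability needed). [folklore] -/
theorem exists_separated_points {S : Set ℝ} {h : ℝ} (hh : 0 < h) (m : ℕ) :
    ∀ a : ℝ, ENNReal.ofReal (2 * h * m) < volume (S ∩ Ici a) →
      ∃ x : ℕ → ℝ, (∀ i, i < m → x i ∈ S ∧ a ≤ x i) ∧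
        ∀ i j, i < j → j < m → x i + h * ((j : ℝ) - i) ≤ x j := by
  induction m with
  | zero =>
    intro a _
    exact ⟨fun _ => 0, fun i hi => (Nat.not_lt_zero i hi).elim,
      fun i j _ hj => (Nat.not_lt_zero j hj).elim⟩
  | succ m ih =>
    intro a hvol
    set T := S ∩ Ici a with hT_def
    have hTne : T.Nonempty := by
      by_contra hcon
      rw [Set.not_nonempty_iff_eq_empty] at hcon
      rw [hcon, measure_empty] at hvol
      exact absurd hvol (not_lt.2 bot_le)
    have hTbdd : BddBelow T := ⟨a, fun x hx => hx.2⟩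
    set t₀ := sInf T with ht₀_def
    obtain ⟨x₀, hx₀T, hx₀lt⟩ : ∃ x₀ ∈ T, x₀ < t₀ + h :=
      exists_lt_of_csInf_lt hTne (by linarith)
    have hsub : T ⊆ (T ∩ Iio (x₀ + h)) ∪ (S ∩ Ici (x₀ + h)) := by
      intro x hx
      by_cases hxlt : x < x₀ + h
      · exact Or.inl ⟨hx, hxlt⟩
      · exact Or.inr ⟨hx.1, not_lt.1 hxlt⟩
    have h1 : volume (T ∩ Iio (x₀ + h)) ≤ ENNReal.ofReal (2 * h) := by
      have hTI : T ∩ Iio (x₀ + h) ⊆ Ico t₀ (t₀ + 2 * h) := by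
        intro x hx
        refine ⟨csInf_le hTbdd hx.1, ?_⟩
        have := hx.2
        rw [Set.mem_Iio] at this
        linarith
      calc volume (T ∩ Iio (x₀ + h)) ≤ volume (Ico t₀ (t₀ + 2 * h)) := measure_mono hTI
        _ = ENNReal.ofReal (2 * h) := by rw [Real.volume_Ico]; ring_nf
    have h2 : ENNReal.ofReal (2 * h * m) < volume (S ∩ Ici (x₀ + h)) := by
      have hsplit : ENNReal.ofReal (2 * h * ((m + 1 : ℕ) : ℝ)) =
          ENNReal.ofReal (2 * h) + ENNReal.ofReal (2 * h * m) := by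
        rw [← ENNReal.ofReal_add (by positivity) (by positivity)]
        congr 1
        push_cast
        ring
      have key : ENNReal.ofReal (2 * h) + ENNReal.ofReal (2 * h * m) <
          ENNReal.ofReal (2 * h) + volume (S ∩ Ici (x₀ + h)) :=
        calc ENNReal.ofReal (2 * h) + ENNReal.ofReal (2 * h * m)
            = ENNReal.ofReal (2 * h * ((m + 1 : ℕ) : ℝ)) := hsplit.symm
          _ < volume T := hvol
          _ ≤ volume (T ∩ Iio (x₀ + h) ∪ S ∩ Ici (x₀ + h)) := measure_mono hsub
          _ ≤ volume (T ∩ Iio (x₀ + h)) + volume (S ∩ Ici (x₀ + h)) := measure_union_le _ _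
          _ ≤ ENNReal.ofReal (2 * h) + volume (S ∩ Ici (x₀ + h)) := by gcongr
      exact (ENNReal.add_lt_add_iff_left ENNReal.ofReal_ne_top).1 key
    obtain ⟨y, hyS, hysep⟩ := ih (x₀ + h) h2
    refine ⟨fun i => Nat.casesOn i x₀ y, ?_, ?_⟩
    · intro i hi
      cases i with
      | zero => exact ⟨hx₀T.1, hx₀T.2⟩
      | succ k =>
        have := hyS k (by omega)
        refine ⟨this.1, ?_⟩
        show a ≤ y k
        have ha : a ≤ x₀ := Set.mem_Ici.1 hx₀T.2
        linarith [this.2]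
    · intro i j hij hj
      cases j with
      | zero => exact (Nat.not_lt_zero i hij).elim
      | succ l =>
        cases i with
        | zero =>
          -- goal : x₀ + h * ((l+1 : ℕ) - 0) ≤ y l
          have hy0 := (hyS 0 (by omega)).2
          rcases Nat.eq_zero_or_pos l with hl | hl
          · subst hl
            simp
            linarith
          · have := hysep 0 l hl (by omega)
            simp at this ⊢
            linarith
        | succ k =>
          have := hysep k l (by omega) (by omega)
          simp at this ⊢
          linarith

/-- `∑_{i ≤ d} 1/(i! (d-i)!) = 2^d / d!`. [folklore] -/
theorem sum_inv_factorial (d : ℕ) :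
    ∑ i ∈ Finset.range (d + 1), (((i ! * (d - i)! : ℕ) : ℝ))⁻¹ = 2 ^ d / d ! := by
  have h : ∀ i ∈ Finset.range (d + 1),
      (((i ! * (d - i)! : ℕ) : ℝ))⁻¹ = (d.choose i : ℝ) / d ! := by
    intro i hi
    rw [Finset.mem_range] at hi
    rw [Nat.cast_choose ℝ (Nat.lt_succ_iff.1 hi)]
    have h1 : (i ! : ℝ) ≠ 0 := by positivity
    have h2 : ((d - i)! : ℝ) ≠ 0 := by positivity
    have h3 : (d ! : ℝ) ≠ 0 := by positivity
    push_cast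
    field_simp
  rw [Finset.sum_congr rfl h, ← Finset.sum_div, ← Nat.cast_sum, Nat.sum_range_choose]
  push_cast
  ring

/-- Lagrange-interpolation bound: if the nodes `x 0, …, x d ∈ [a, b]` are `h`-separated
(`x j ≥ x i + h (j - i)` for `i < j`) and `|q| ≤ B` at the nodes, then
`|q t| ≤ B ((b - a)/h)^d 2^d / d!` on `[a, b]` for every `q` of degree `≤ d`. [folklore] -/
theorem abs_eval_le_of_nodes {d : ℕ} {q : ℝ[X]} (hq : q.natDegree ≤ d) {a b h B : ℝ}
    (hh : 0 < h) {x : ℕ → ℝ} (hxI : ∀ i ≤ d, x i ∈ Icc a b)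
    (hsep : ∀ i j, i < j → j ≤ d → x i + h * ((j : ℝ) - i) ≤ x j)
    (hB : ∀ i ≤ d, |q.eval (x i)| ≤ B) {t : ℝ} (ht : t ∈ Icc a b) :
    |q.eval t| ≤ B * (((b - a) / h) ^ d * (2 ^ d / d !)) := by
  classical
  -- `∏_{j ≤ D, j ≠ i} |i - j| = i! (D - i)!` (the same identity is proved, for its own purposes, as
  -- `Literature.Barriers.NavierStokesRegularity.LiSinai.prod_abs_sub_eq_factorial`; that
  -- Navier–Stokes barrier module is deliberately not imported into this file).
  have hprod : ∀ (D i : ℕ), i ≤ D →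
      ∏ j ∈ (Finset.range (D + 1)).erase i, |(i : ℝ) - j| = ((i ! * (D - i)! : ℕ) : ℝ) := by
    intro D i hi
    obtain ⟨k, rfl⟩ := Nat.exists_eq_add_of_le hi
    clear hi
    induction k with
    | zero =>
      simp only [add_zero, Nat.sub_self, Nat.factorial_zero, mul_one]
      rw [Finset.range_add_one, Finset.erase_insert (by simp),
        ← Finset.prod_range_add_one_eq_factorial, Nat.cast_prod,
        ← Finset.prod_range_reflect (fun j => ((j + 1 : ℕ) : ℝ)) i]
      refine Finset.prod_congr rfl fun j hj => ?_
      rw [Finset.mem_range] at hj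
      have h1 : ((i - 1 - j : ℕ) : ℝ) = i - 1 - j := by
        rw [Nat.cast_sub (by omega), Nat.cast_sub (by omega)]
        ring
      rw [abs_of_nonneg (by
        have : (j : ℝ) ≤ i := by exact_mod_cast hj.le
        linarith)]
      push_cast
      rw [h1]
      ring
    | succ k ih =>
      rw [show i + (k + 1) + 1 = (i + k + 1) + 1 from by ring, Finset.range_add_one,
        Finset.erase_insert_of_ne (by omega), Finset.prod_insert (by simp), ih]
      have h1 : |(i : ℝ) - ((i + k + 1 : ℕ) : ℝ)| = ((k + 1 : ℕ) : ℝ) := by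
        rw [abs_sub_comm, abs_of_nonneg] <;> push_cast <;> ring_nf
        positivity
      rw [h1, show i + (k + 1) - i = (k + 1) from by omega, show i + k - i = k from by omega,
        Nat.factorial_succ]
      push_cast
      ring
  set s : Finset ℕ := Finset.range (d + 1) with hs_def
  have hmem : ∀ {i}, i ∈ s → i ≤ d := fun hi => Nat.lt_succ_iff.1 (Finset.mem_range.1 hi)
  have hgap : ∀ i j, i ≠ j → i ≤ d → j ≤ d → h * |(i : ℝ) - j| ≤ |x i - x j| := by
    intro i j hij hi hj
    rcases lt_or_gt_of_ne hij with hlt | hlt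
    · have h1 := hsep i j hlt hj
      have h2 : (i : ℝ) < j := by exact_mod_cast hlt
      rw [abs_sub_comm ((i : ℝ)), abs_of_pos (by linarith), abs_sub_comm, abs_of_pos (by nlinarith)]
      linarith
    · have h1 := hsep j i hlt hi
      have h2 : (j : ℝ) < i := by exact_mod_cast hlt
      rw [abs_of_pos (by linarith : (0:ℝ) < i - j), abs_of_pos (by nlinarith)]
      linarith
  have hinj : Set.InjOn x (s : Set ℕ) := by
    intro i hi j hj hxij
    by_contra hij
    have := hgap i j hij (hmem hi) (hmem hj)
    rw [hxij, sub_self, abs_zero] at this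
    have hpos : 0 < h * |(i : ℝ) - j| := by
      apply mul_pos hh
      rw [abs_pos, sub_ne_zero]
      exact_mod_cast hij
    linarith
  have hdeg : q.degree < (s.card : WithBot ℕ) := by
    rw [hs_def, Finset.card_range]
    refine lt_of_le_of_lt (Polynomial.degree_le_of_natDegree_le hq) ?_
    exact_mod_cast Nat.lt_succ_self d
  have hinterp := Lagrange.eq_interpolate (F := ℝ) hinj hdeg
  have heval : q.eval t = ∑ i ∈ s, q.eval (x i) * (Lagrange.basis s x i).eval t := by
    conv_lhs => rw [hinterp]
    rw [Lagrange.interpolate_apply, Polynomial.eval_finsetSum]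
    simp only [Polynomial.eval_mul, Polynomial.eval_C]
  have hB0 : 0 ≤ B := (abs_nonneg _).trans (hB 0 (Nat.zero_le _))
  have hba : 0 ≤ b - a := by linarith [ht.1, ht.2]
  -- bound on each Lagrange basis polynomial
  have hbasis : ∀ i ∈ s, |(Lagrange.basis s x i).eval t| ≤
      ((b - a) / h) ^ d * (((i ! * (d - i)! : ℕ) : ℝ))⁻¹ := by
    intro i hi
    have hid : i ≤ d := hmem hi
    rw [Lagrange.basis, Polynomial.eval_prod, Finset.abs_prod]
    have hfac : ∀ j ∈ s.erase i, |Polynomial.eval t (Lagrange.basisDivisor (x i) (x j))|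
        ≤ (b - a) / h * |(i : ℝ) - j|⁻¹ := by
      intro j hj
      obtain ⟨hji, hjs⟩ := Finset.mem_erase.1 hj
      have hjd : j ≤ d := hmem hjs
      simp only [Lagrange.basisDivisor, Polynomial.eval_mul, Polynomial.eval_C, Polynomial.eval_sub,
        Polynomial.eval_X, abs_mul, abs_inv]
      have hg := hgap i j (Ne.symm hji) hid hjd
      have hijpos : 0 < |(i : ℝ) - j| := by
        rw [abs_pos, sub_ne_zero]; exact_mod_cast (Ne.symm hji)
      have hnum : |t - x j| ≤ b - a := by
        rw [abs_sub_le_iff]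
        constructor <;> linarith [ht.1, ht.2, (hxI j hjd).1, (hxI j hjd).2]
      calc |x i - x j|⁻¹ * |t - x j| ≤ (h * |(i : ℝ) - j|)⁻¹ * (b - a) := by
            apply mul_le_mul (inv_anti₀ (mul_pos hh hijpos) hg) hnum (abs_nonneg _)
            exact inv_nonneg.2 (mul_pos hh hijpos).le
        _ = (b - a) / h * |(i : ℝ) - j|⁻¹ := by
            rw [mul_inv, div_eq_mul_inv]; ring
    calc ∏ j ∈ s.erase i, |Polynomial.eval t (Lagrange.basisDivisor (x i) (x j))|
        ≤ ∏ j ∈ s.erase i, ((b - a) / h * |(i : ℝ) - j|⁻¹) :=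
          Finset.prod_le_prod (fun j _ => abs_nonneg _) hfac
      _ = ((b - a) / h) ^ d * (((i ! * (d - i)! : ℕ) : ℝ))⁻¹ := by
          rw [Finset.prod_mul_distrib, Finset.prod_const, Finset.card_erase_of_mem hi, hs_def,
            Finset.card_range, Nat.add_sub_cancel, Finset.prod_inv_distrib,
            hprod d i hid]
  calc |q.eval t| = |∑ i ∈ s, q.eval (x i) * (Lagrange.basis s x i).eval t| := by rw [heval]
    _ ≤ ∑ i ∈ s, |q.eval (x i) * (Lagrange.basis s x i).eval t| := Finset.abs_sum_le_sum_abs _ _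
    _ = ∑ i ∈ s, |q.eval (x i)| * |(Lagrange.basis s x i).eval t| := by simp_rw [abs_mul]
    _ ≤ ∑ i ∈ s, B * (((b - a) / h) ^ d * (((i ! * (d - i)! : ℕ) : ℝ))⁻¹) :=
        Finset.sum_le_sum fun i hi =>
          mul_le_mul (hB i (hmem hi)) (hbasis i hi) (abs_nonneg _) hB0
    _ = B * (((b - a) / h) ^ d * ∑ i ∈ s, (((i ! * (d - i)! : ℕ) : ℝ))⁻¹) := by
        rw [Finset.mul_sum, Finset.mul_sum]
    _ = B * (((b - a) / h) ^ d * (2 ^ d / d !)) := by rw [hs_def, sum_inv_factorial]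

/-- **Weak Remez inequality** (Lemma 4 of Carbery–Wright in Remez form, with a non-sharp
absolute constant): if `q` has degree `≤ d`, `S ⊆ [a, b]` has Lebesgue (outer) measure `≥ s > 0`
and `|q| ≤ B` on `S`, then `|q| ≤ e (8e(b-a)/s)^d B` on `[a, b]`. Equivalent (up to the value
of the absolute constant) to the sublevel-set form printed as Lemma 4; proved here by Lagrange
interpolation at `d + 1` well-separated nodes of `S` rather than by Cartan's lemma.
[cite: CarberyWright2001, Lemma 4 (p. 240)] -/
theorem remez_weak {d : ℕ} {q : ℝ[X]} (hq : q.natDegree ≤ d) {a b s B : ℝ} (hs : 0 < s)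
    {S : Set ℝ} (hSsub : S ⊆ Icc a b) (hSvol : ENNReal.ofReal s ≤ volume S)
    (hB : ∀ y ∈ S, |q.eval y| ≤ B) {t : ℝ} (ht : t ∈ Icc a b) :
    |q.eval t| ≤ Real.exp 1 * (8 * Real.exp 1 * (b - a) / s) ^ d * B := by
  set h := s / (4 * ((d : ℝ) + 1)) with hh_def
  have hh : 0 < h := by positivity
  have hvol : ENNReal.ofReal (2 * h * ((d + 1 : ℕ) : ℝ)) < volume (S ∩ Ici a) := by
    have hSa : S ∩ Ici a = S := Set.inter_eq_left.2 fun x hx => (hSsub hx).1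
    rw [hSa]
    refine lt_of_lt_of_le ?_ hSvol
    rw [ENNReal.ofReal_lt_ofReal_iff hs]
    have : 2 * h * ((d + 1 : ℕ) : ℝ) = s / 2 := by
      rw [hh_def]; push_cast; field_simp; ring
    linarith
  obtain ⟨x, hxS, hsep⟩ := exists_separated_points hh (d + 1) a hvol
  have hxI : ∀ i ≤ d, x i ∈ Icc a b := fun i hi => hSsub (hxS i (Nat.lt_succ_of_le hi)).1
  have hBi : ∀ i ≤ d, |q.eval (x i)| ≤ B := fun i hi => hB _ (hxS i (Nat.lt_succ_of_le hi)).1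
  have hsep' : ∀ i j, i < j → j ≤ d → x i + h * ((j : ℝ) - i) ≤ x j :=
    fun i j hij hj => hsep i j hij (Nat.lt_succ_of_le hj)
  have hmain := abs_eval_le_of_nodes hq hh hxI hsep' hBi ht
  have hB0 : 0 ≤ B := (abs_nonneg _).trans (hBi 0 (Nat.zero_le _))
  have hba : 0 ≤ b - a := by linarith [ht.1, ht.2]
  have hkey : ((b - a) / h) ^ d * (2 ^ d / d !) ≤
      Real.exp 1 * (8 * Real.exp 1 * (b - a) / s) ^ d := by
    have hq' : (b - a) / h = (8 * (b - a) / s) * (((d : ℝ) + 1) / 2) := by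
      rw [hh_def]; field_simp; ring
    have h2d : (2 : ℝ) ^ d ≠ 0 := pow_ne_zero _ two_ne_zero
    have hdf : ((d ! : ℕ) : ℝ) ≠ 0 := by positivity
    have h1 : ((b - a) / h) ^ d * (2 ^ d / d !) =
        (8 * (b - a) / s) ^ d * (((d : ℝ) + 1) ^ d / d !) := by
      rw [hq', mul_pow, mul_assoc]
      congr 1
      rw [div_pow, div_mul_div_comm, mul_comm ((2 : ℝ) ^ d) (d ! : ℝ), mul_div_mul_right _ _ h2d]
    have h2 : ((d : ℝ) + 1) ^ d / d ! ≤ Real.exp ((d : ℝ) + 1) :=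
      Real.pow_div_factorial_le_exp _ (by positivity) d
    have h3 : Real.exp ((d : ℝ) + 1) = Real.exp 1 * (Real.exp 1) ^ d := by
      rw [Real.exp_one_pow, ← Real.exp_add]; ring_nf
    rw [h1]
    calc (8 * (b - a) / s) ^ d * (((d : ℝ) + 1) ^ d / d !)
        ≤ (8 * (b - a) / s) ^ d * (Real.exp 1 * (Real.exp 1) ^ d) := by
          rw [← h3]; gcongr
      _ = Real.exp 1 * (8 * Real.exp 1 * (b - a) / s) ^ d := by
          rw [show 8 * Real.exp 1 * (b - a) / s = Real.exp 1 * (8 * (b - a) / s) by ring, mul_pow]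
          ring
  calc |q.eval t| ≤ B * (((b - a) / h) ^ d * (2 ^ d / d !)) := hmain
    _ ≤ B * (Real.exp 1 * (8 * Real.exp 1 * (b - a) / s) ^ d) :=
        mul_le_mul_of_nonneg_left hkey hB0
    _ = Real.exp 1 * (8 * Real.exp 1 * (b - a) / s) ^ d * B := by ring

end OneDim

section Line

/-- Restricting a real polynomial in `n` variables to the line `t ↦ x₀ + t • v` gives a univariate
polynomial of degree at most the total degree. [folklore] -/
theorem exists_linePoly {n : ℕ} (p : MvPolynomial (Fin n) ℝ) (x₀ v : Fin n → ℝ) :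
    ∃ q : Polynomial ℝ, q.natDegree ≤ p.totalDegree ∧
      ∀ t : ℝ, q.eval t = MvPolynomial.eval (x₀ + t • v) p := by
  refine ⟨MvPolynomial.aeval (fun i => Polynomial.C (v i) * Polynomial.X + Polynomial.C (x₀ i)) p,
    ?_, ?_⟩
  · have := MvPolynomial.aeval_natDegree_le (m := p.totalDegree) (n := 1) p le_rfl
      (fun i => Polynomial.C (v i) * Polynomial.X + Polynomial.C (x₀ i))
      (fun i => Polynomial.natDegree_linear_le)
    simpa using this
  · intro t
    induction p using MvPolynomial.induction_on with
    | C a => simp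
    | add p q hp hq => simp [hp, hq]
    | mul_X p i hp =>
      simp only [map_mul, MvPolynomial.aeval_X, Polynomial.eval_mul, hp, Polynomial.eval_add,
        Polynomial.eval_C, Polynomial.eval_X, MvPolynomial.eval_X, Pi.add_apply, Pi.smul_apply,
        smul_eq_mul]
      ring

end Line

section Polar

open Metric MeasureTheory.Measure
open scoped ENNReal

variable {E : Type*} [NormedAddCommGroup E] [NormedSpace ℝ E] [MeasurableSpace E] [BorelSpace E]
  [FiniteDimensional ℝ E] (μ : Measure E) [μ.IsAddHaarMeasure]

/-- Polar-coordinate formula for the measure of a measurable set avoiding the origin: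
integrate, over directions `θ` (w.r.t. `μ.toSphere`), the `r^{dim-1} dr`-measure of the radial
slice `{r > 0 : r θ ∈ A}`. [folklore] -/
theorem measure_eq_lintegral_volumeIoiPow {A : Set E} (hA : MeasurableSet A) (h0 : (0 : E) ∉ A) :
    μ A = ∫⁻ θ : sphere (0 : E) 1,
      volumeIoiPow (Module.finrank ℝ E - 1) {r : Ioi (0 : ℝ) | r.1 • (θ : E) ∈ A} ∂μ.toSphere := by
  set e := homeomorphUnitSphereProd E with he
  have hpres := μ.measurePreserving_homeomorphUnitSphereProd
  set A' : Set ({(0 : E)}ᶜ : Set E) := Subtype.val ⁻¹' A with hA'_def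
  have hA' : MeasurableSet A' := measurable_subtype_coe hA
  have hB : MeasurableSet (e.symm ⁻¹' A') := e.symm.measurable hA'
  have h1 : μ A = μ.comap Subtype.val A' := by
    rw [comap_subtype_coe_apply (measurableSet_singleton (0 : E)).compl, hA'_def,
      Subtype.image_preimage_coe, Set.inter_eq_right.2]
    intro x hx
    rw [Set.mem_compl_iff, Set.mem_singleton_iff]
    rintro rfl
    exact h0 hx
  have h2 : μ.comap Subtype.val A' =
      (μ.toSphere.prod (volumeIoiPow (Module.finrank ℝ E - 1))) (e.symm ⁻¹' A') := by
    rw [← hpres.measure_preimage hB.nullMeasurableSet, ← Set.preimage_comp]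
    congr 1
    ext x
    simp [he]
  rw [h1, h2, Measure.prod_apply hB]
  congr 1

/-- The radial measure of a slice, as a set integral over `ℝ`. [folklore] -/
theorem volumeIoiPow_apply_preimage (m : ℕ) {S : Set ℝ} (hS : MeasurableSet S)
    (hS0 : S ⊆ Ioi 0) :
    volumeIoiPow m (Subtype.val ⁻¹' S) = ∫⁻ r in S, ENNReal.ofReal (r ^ m) := by
  rw [volumeIoiPow, withDensity_apply _ (measurable_subtype_coe hS),
    setLIntegral_subtype measurableSet_Ioi _ (fun a : ℝ => ENNReal.ofReal (a ^ m)),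
    Subtype.image_preimage_coe, Set.inter_eq_right.2 hS0]

variable [Nontrivial E]

/-- Polar slicing about an arbitrary base point `x₀` (translation invariance + the origin is
null). [folklore] -/
theorem measure_eq_lintegral_raySlice (x₀ : E) {T : Set E} (hT : MeasurableSet T) :
    μ T = ∫⁻ θ : sphere (0 : E) 1, volumeIoiPow (Module.finrank ℝ E - 1)
      (Subtype.val ⁻¹' {r : ℝ | 0 < r ∧ x₀ + r • (θ : E) ∈ T}) ∂μ.toSphere := by
  set A := ((fun y => x₀ + y) ⁻¹' T) \ {0} with hA_def
  have hA : MeasurableSet A := ((measurable_const_add x₀) hT).diff (measurableSet_singleton 0)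
  have h0 : (0 : E) ∉ A := fun h => h.2 rfl
  have h1 : μ T = μ A := by
    rw [hA_def, measure_sdiff_null (measure_singleton 0), measure_preimage_add]
  rw [h1, measure_eq_lintegral_volumeIoiPow μ hA h0]
  refine lintegral_congr fun θ => ?_
  congr 1
  ext r
  simp only [hA_def, mem_setOf_eq, mem_sdiff, mem_preimage, mem_singleton_iff]
  constructor
  · rintro ⟨h, -⟩
    exact ⟨r.2, h⟩
  · rintro ⟨-, h⟩
    exact ⟨h, smul_ne_zero r.2.out.ne' (ne_zero_of_mem_unit_sphere θ)⟩

/-- **Ray comparison (Brudnyi–Ganzburg).** Let `ω ⊆ K` be measurable, `x₀` a base point and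
`L θ ≥ 0` "ray lengths" such that the ray `{x₀ + r θ : r > 0}` meets `K` inside `r ≤ L θ` and
contains `0 < r < L θ`. If on every ray the linear measure of `ω` is `≤ κ L θ`, then
`μ ω ≤ dim(E) κ μ K`: the radial weight `r^{dim-1}` on `[0, L]` is at most `dim` times its
average — the comparison `(λ-t)^{n-1} ≤ n ∫₀¹ (λ-s)^{n-1} ds` of the printed proof, in the ray
form of Brudnyi–Ganzburg. [cite: CarberyWright2001, p. 241] -/
theorem measure_le_of_raySlice_bound {K ω : Set E} (hK : MeasurableSet K)
    (hω : MeasurableSet ω) (hωK : ω ⊆ K) (x₀ : E) (L : sphere (0 : E) 1 → ℝ)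
    (hL0 : ∀ θ, 0 ≤ L θ)
    (hLK : ∀ (θ : sphere (0 : E) 1) (r : ℝ), 0 < r → x₀ + r • (θ : E) ∈ K → r ≤ L θ)
    (hKL : ∀ (θ : sphere (0 : E) 1) (r : ℝ), 0 < r → r < L θ → x₀ + r • (θ : E) ∈ K)
    {κ : ℝ} (hκ : 0 ≤ κ)
    (hyp : ∀ θ : sphere (0 : E) 1,
      volume {r : ℝ | 0 < r ∧ x₀ + r • (θ : E) ∈ ω} ≤ ENNReal.ofReal (κ * L θ)) :
    μ ω ≤ ENNReal.ofReal (Module.finrank ℝ E * κ) * μ K := by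
  set n := Module.finrank ℝ E with hn_def
  have hn : 0 < n := Module.finrank_pos
  have hn1 : n - 1 + 1 = n := Nat.sub_add_cancel hn
  rw [measure_eq_lintegral_raySlice μ x₀ hω, measure_eq_lintegral_raySlice μ x₀ hK,
    ← lintegral_const_mul' _ _ ENNReal.ofReal_ne_top]
  refine lintegral_mono fun θ => ?_
  have hθ : Continuous fun r : ℝ => x₀ + r • (θ : E) := by fun_prop
  set ℓ := L θ with hℓ_def
  have hℓ0 : 0 ≤ ℓ := hL0 θ
  set Sω := {r : ℝ | 0 < r ∧ x₀ + r • (θ : E) ∈ ω} with hSω_def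
  set SK := {r : ℝ | 0 < r ∧ x₀ + r • (θ : E) ∈ K} with hSK_def
  have hSω_meas : MeasurableSet Sω := measurableSet_Ioi.inter (hθ.measurable hω)
  -- (a) upper bound on the `ω`-slice
  have ha : volumeIoiPow (n - 1) (Subtype.val ⁻¹' Sω) ≤
      ENNReal.ofReal (n * κ) * ENNReal.ofReal (ℓ ^ n / n) := by
    rw [volumeIoiPow_apply_preimage (n - 1) hSω_meas (fun r hr => hr.1)]
    calc ∫⁻ r in Sω, ENNReal.ofReal (r ^ (n - 1))
        ≤ ∫⁻ r in Sω, ENNReal.ofReal (ℓ ^ (n - 1)) := by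
          refine setLIntegral_mono' hSω_meas fun r hr => ?_
          have hrℓ : r ≤ ℓ := hLK θ r hr.1 (hωK hr.2)
          exact ENNReal.ofReal_le_ofReal (pow_le_pow_left₀ hr.1.le hrℓ _)
      _ = ENNReal.ofReal (ℓ ^ (n - 1)) * volume Sω := setLIntegral_const _ _
      _ ≤ ENNReal.ofReal (ℓ ^ (n - 1)) * ENNReal.ofReal (κ * ℓ) := by gcongr; exact hyp θ
      _ = ENNReal.ofReal (n * κ) * ENNReal.ofReal (ℓ ^ n / n) := by
          rw [← ENNReal.ofReal_mul (pow_nonneg hℓ0 _), ← ENNReal.ofReal_mul (by positivity)]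
          congr 1
          have hnR : (n : ℝ) ≠ 0 := by exact_mod_cast hn.ne'
          have : (ℓ ^ n : ℝ) = ℓ ^ (n - 1) * ℓ := by
            conv_lhs => rw [← hn1]
            rw [pow_succ]
          rw [this]
          field_simp
  -- (b) lower bound on the `K`-slice
  have hb : ENNReal.ofReal (ℓ ^ n / n) ≤ volumeIoiPow (n - 1) (Subtype.val ⁻¹' SK) := by
    rcases hℓ0.eq_or_lt with hℓ0 | hℓpos
    · rw [← hℓ0, zero_pow hn.ne', zero_div, ENNReal.ofReal_zero]
      exact bot_le
    · have hsub : Iio (⟨ℓ, hℓpos⟩ : Ioi (0 : ℝ)) ⊆ Subtype.val ⁻¹' SK := by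
        intro r hr
        exact ⟨r.2, hKL θ r.1 r.2 hr⟩
      calc ENNReal.ofReal (ℓ ^ n / n) = volumeIoiPow (n - 1) (Iio ⟨ℓ, hℓpos⟩) := by
            rw [volumeIoiPow_apply_Iio]
            congr 1
            rw [hn1, Nat.cast_pred hn, sub_add_cancel]
        _ ≤ _ := measure_mono hsub
  calc volumeIoiPow (n - 1) (Subtype.val ⁻¹' Sω)
      ≤ ENNReal.ofReal (n * κ) * ENNReal.ofReal (ℓ ^ n / n) := ha
    _ ≤ ENNReal.ofReal (n * κ) * volumeIoiPow (n - 1) (Subtype.val ⁻¹' SK) := by gcongr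

omit [MeasurableSpace E] [BorelSpace E] [FiniteDimensional ℝ E] [Nontrivial E] in
/-- Ray lengths for a compact convex set from an interior-or-boundary base point. [folklore] -/
theorem exists_rayLength {K : Set E} (hKc : IsCompact K) (hKconv : Convex ℝ K) {x₀ : E}
    (hx₀ : x₀ ∈ K) (θ : E) (hθ : ‖θ‖ = 1) :
    ∃ L : ℝ, 0 ≤ L ∧ (∀ r : ℝ, 0 < r → x₀ + r • θ ∈ K → r ≤ L) ∧
      (∀ r : ℝ, 0 < r → r < L → x₀ + r • θ ∈ K) := by
  set J := {r : ℝ | 0 ≤ r ∧ x₀ + r • θ ∈ K} with hJ_def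
  have h0J : (0 : ℝ) ∈ J := ⟨le_rfl, by simpa using hx₀⟩
  obtain ⟨R, hR⟩ := (Metric.isBounded_iff_subset_closedBall x₀).1 hKc.isBounded
  have hJbdd : BddAbove J := by
    refine ⟨R, fun r hr => ?_⟩
    have h1 : x₀ + r • θ ∈ closedBall x₀ R := hR hr.2
    rw [mem_closedBall, dist_eq_norm, add_sub_cancel_left, norm_smul, hθ, mul_one,
      Real.norm_eq_abs, abs_of_nonneg hr.1] at h1
    exact h1
  refine ⟨sSup J, le_csSup hJbdd h0J, fun r hr hrK => le_csSup hJbdd ⟨hr.le, hrK⟩,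
    fun r hr hrL => ?_⟩
  obtain ⟨r', hr'J, hrr'⟩ := exists_lt_of_lt_csSup ⟨0, h0J⟩ hrL
  have hr'pos : 0 < r' := hr.trans hrr'
  have := hKconv.add_smul_mem hx₀ hr'J.2 (t := r / r')
    ⟨by positivity, (div_le_one hr'pos).2 hrr'.le⟩
  rwa [smul_smul, div_mul_cancel₀ _ hr'pos.ne'] at this

end Polar

section Main

open Metric MeasureTheory.Measure
open scoped ENNReal

/-- **Carbery–Wright, Theorem 2 at `q = ∞` (scalar case; Brudnyi–Ganzburg): the named fact
`CarberyWright.supSublevelBound` holds**, with `C = 16 e²`: for `n, d ≥ 1`, a real polynomial `p`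
of degree `≤ d` on `ℝⁿ`, a convex body `K` of volume `1` and `α > 0`,
`(sup_K |p|)^{1/d} · α⁻¹ · vol{x ∈ K : |p(x)|^{1/d} ≤ α} ≤ 16 e² n`.
Proof: maximum point `x₀`, polar slicing about `x₀` (`measure_le_of_raySlice_bound`), and the
one-dimensional Remez step (`remez_weak`) on an extremal chord; see the module docstring.
[cite: CarberyWright2001, Thm 2 (q = ∞)] -/
theorem supSublevelBound_holds : supSublevelBound := by
  refine ⟨16 * (Real.exp 1) ^ 2, by positivity, ?_⟩
  intro n d hn hd p hp K hK hKconv hKint hKvol α hα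
  haveI : Nonempty (Fin n) := ⟨⟨0, hn⟩⟩
  set f : (Fin n → ℝ) → ℝ := fun x => |MvPolynomial.eval x p| with hf_def
  have hfc : Continuous f := (MvPolynomial.continuous_eval p).abs
  have hKne : K.Nonempty := hKint.mono interior_subset
  obtain ⟨x₀, hx₀K, hmax⟩ := hK.exists_isMaxOn hKne hfc.continuousOn
  have hmax' : ∀ y ∈ K, f y ≤ f x₀ := fun y hy => isMaxOn_iff.1 hmax y hy
  have hsup : sSup (f '' K) = f x₀ :=
    IsGreatest.csSup_eq ⟨mem_image_of_mem f hx₀K, forall_mem_image.2 fun y hy => hmax' y hy⟩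
  change (sSup (f '' K)) ^ ((1 : ℝ) / d) * α⁻¹ *
      (volume {x | x ∈ K ∧ f x ^ ((1 : ℝ) / d) ≤ α}).toReal ≤ 16 * Real.exp 1 ^ 2 * n
  rw [hsup]
  set M := f x₀ with hM_def
  have hM0 : 0 ≤ M := abs_nonneg _
  have hdpos : (0 : ℝ) < d := by exact_mod_cast hd
  -- the sublevel set
  set ω := {x | x ∈ K ∧ f x ≤ α ^ d} with hω_def
  have hSω : {x | x ∈ K ∧ f x ^ ((1 : ℝ) / d) ≤ α} = ω := by
    ext x
    simp only [mem_setOf_eq, hω_def]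
    rw [one_div, Real.rpow_inv_le_iff_of_pos (abs_nonneg _) hα.le hdpos, Real.rpow_natCast]
  rw [hSω]
  -- trivial case `M = 0`
  rcases hM0.eq_or_lt with hM | hMpos
  · rw [← hM, Real.zero_rpow (by positivity), zero_mul, zero_mul]
    positivity
  -- main case
  have hωK : ω ⊆ K := fun x hx => hx.1
  have hω_closed : IsClosed ω := by
    have : ω = K ∩ f ⁻¹' Iic (α ^ d) := by ext x; simp [hω_def]
    rw [this]
    exact hK.isClosed.inter (isClosed_Iic.preimage hfc)
  have hω_meas : MeasurableSet ω := hω_closed.measurableSet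
  have hvolω_le : volume ω ≤ 1 := (measure_mono hωK).trans hKvol.le
  have hvolω_ne_top : volume ω ≠ ⊤ := ne_top_of_le_ne_top ENNReal.one_ne_top hvolω_le
  have hMd : 0 < M ^ ((1 : ℝ) / d) := Real.rpow_pos_of_pos hMpos _
  suffices hclaim : (volume ω).toReal ≤ n * (16 * Real.exp 1 ^ 2 * α / M ^ ((1 : ℝ) / d)) by
    calc M ^ ((1 : ℝ) / d) * α⁻¹ * (volume ω).toReal
        ≤ M ^ ((1 : ℝ) / d) * α⁻¹ * (n * (16 * Real.exp 1 ^ 2 * α / M ^ ((1 : ℝ) / d))) := by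
          gcongr
      _ = 16 * Real.exp 1 ^ 2 * n := by field_simp
  by_contra hcon
  push Not at hcon
  set κ := 16 * Real.exp 1 ^ 2 * α / M ^ ((1 : ℝ) / d) with hκ_def
  have hκpos : 0 < κ := by positivity
  -- ray lengths from `x₀`
  have hray : ∀ θ : sphere (0 : Fin n → ℝ) 1, ∃ L : ℝ, 0 ≤ L ∧
      (∀ r : ℝ, 0 < r → x₀ + r • (θ : Fin n → ℝ) ∈ K → r ≤ L) ∧
      (∀ r : ℝ, 0 < r → r < L → x₀ + r • (θ : Fin n → ℝ) ∈ K) :=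
    fun θ => exists_rayLength hK hKconv hx₀K θ (norm_eq_of_mem_sphere θ)
  choose L hL0 hLK hKL using hray
  have hfin : Module.finrank ℝ (Fin n → ℝ) = n := Module.finrank_fin_fun ℝ
  -- a ray on which `ω` is relatively long
  obtain ⟨θ, hθ⟩ : ∃ θ : sphere (0 : Fin n → ℝ) 1,
      ENNReal.ofReal (κ * L θ) < volume {r : ℝ | 0 < r ∧ x₀ + r • (θ : Fin n → ℝ) ∈ ω} := by
    by_contra hall
    push Not at hall
    have h1 := measure_le_of_raySlice_bound volume hK.isClosed.measurableSet hω_meas hωK x₀ L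
      hL0 hLK hKL hκpos.le hall
    rw [hfin, hKvol, mul_one] at h1
    have h2 : (volume ω).toReal ≤ n * κ := ENNReal.toReal_le_of_le_ofReal (by positivity) h1
    linarith
  -- the chord through `x₀` in direction `θ`
  set ℓ := L θ with hℓ_def
  set S := {r : ℝ | 0 < r ∧ x₀ + r • (θ : Fin n → ℝ) ∈ ω} with hS_def
  have hSsub : S ⊆ Icc 0 ℓ := fun r hr => ⟨hr.1.le, hLK θ r hr.1 (hωK hr.2)⟩
  have hSne : S.Nonempty := by
    by_contra h
    rw [Set.not_nonempty_iff_eq_empty] at h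
    rw [h, measure_empty] at hθ
    exact absurd hθ (not_lt.2 bot_le)
  have hℓpos : 0 < ℓ := by
    obtain ⟨r, hr⟩ := hSne
    exact hr.1.trans_le (hSsub hr).2
  obtain ⟨q, hqdeg, hqeval⟩ := exists_linePoly p x₀ (θ : Fin n → ℝ)
  have hqd : q.natDegree ≤ d := hqdeg.trans hp
  have hB : ∀ y ∈ S, |q.eval y| ≤ α ^ d := fun y hy => by rw [hqeval]; exact hy.2.2
  have hrem := remez_weak hqd (by positivity : 0 < κ * ℓ) hSsub hθ.le hB
    (left_mem_Icc.2 hℓpos.le)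
  have hq0 : q.eval 0 = MvPolynomial.eval x₀ p := by rw [hqeval]; simp
  rw [hq0, sub_zero] at hrem
  -- `hrem : M ≤ e (8eℓ/(κℓ))^d α^d`; simplify the constant
  have h1 : 8 * Real.exp 1 * ℓ / (κ * ℓ) = M ^ ((1 : ℝ) / d) / (2 * Real.exp 1 * α) := by
    rw [hκ_def]
    field_simp
    ring
  have h2 : (M ^ ((1 : ℝ) / d)) ^ d = M := by
    rw [one_div]
    exact Real.rpow_inv_natCast_pow hM0 (by omega)
  have h3 : Real.exp 1 * (8 * Real.exp 1 * ℓ / (κ * ℓ)) ^ d * α ^ d =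
      M * (Real.exp 1 / (2 * Real.exp 1) ^ d) := by
    rw [h1, div_pow, h2, mul_pow ((2 : ℝ) * Real.exp 1) α d]
    field_simp
  have h4 : Real.exp 1 / (2 * Real.exp 1) ^ d ≤ 1 / 2 := by
    have he : (2 : ℝ) ≤ Real.exp 1 := by
      have := Real.add_one_le_exp (1 : ℝ)
      linarith
    rw [div_le_div_iff₀ (by positivity) (by positivity), one_mul]
    calc Real.exp 1 * 2 = (2 * Real.exp 1) ^ 1 := by ring
      _ ≤ (2 * Real.exp 1) ^ d := pow_le_pow_right₀ (by linarith) hd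
  have hM' : M ≤ M * (1 / 2) := by
    calc M = f x₀ := rfl
      _ ≤ Real.exp 1 * (8 * Real.exp 1 * ℓ / (κ * ℓ)) ^ d * α ^ d := hrem
      _ = M * (Real.exp 1 / (2 * Real.exp 1) ^ d) := h3
      _ ≤ M * (1 / 2) := mul_le_mul_of_nonneg_left h4 hM0
  linarith

end Main


/-! ## Part 2 — Theorem 1 at `r = 0`, `q = ∞`: `supLeGeometricMean_holds`

See the module docstring (Part 2) for the architecture: polar coordinates about a maximiser of
`|p|` on `K` and a one-dimensional root-factorisation lemma (the mechanism of the paper's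
Lemma 1), giving `∫_K (log M - log |p|) ≤ d (log 2 + 1 + log n)` and the constant `C = 2e`. -/

open _root_.MeasureTheory _root_.Set _root_.Real _root_.intervalIntegral _root_.Metric
open scoped ENNReal

section GeometricMeanOneDim

/-- `∫₀¹ log |u - b| du = b log b + (1 - b) log (1 - b) - 1`. [folklore] -/
private theorem integral_log_abs_sub (b : ℝ) :
    ∫ u in (0:ℝ)..1, Real.log |u - b| = b * Real.log b + (1 - b) * Real.log (1 - b) - 1 := by
  simp_rw [Real.log_abs]
  rw [intervalIntegral.integral_comp_sub_right (fun t => Real.log t) b, integral_log]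
  simp only [zero_sub, Real.log_neg_eq_log]
  ring

/-- `b log b + (1 - b) log (1 - b) ≥ -log 2` (binary entropy bound). [folklore] -/
private theorem entropy_bound (b : ℝ) :
    -Real.log 2 ≤ b * Real.log b + (1 - b) * Real.log (1 - b) := by
  have h := Real.binEntropy_le_log_two (p := b)
  unfold Real.binEntropy at h
  simp only [Real.log_inv] at h
  linarith

/-- The kernel bound: for `a ∈ [0,1]`,
`(m+1) ∫₀¹ s^m log |s - a| ds ≥ -(log 2 + 1 + log (m+1))`
(via `|s^{m+1} - a^{m+1}| ≤ (m+1)|s - a|` and the substitution `u = s^{m+1}`). [folklore] -/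
private theorem kernel_bound (m : ℕ) {a : ℝ} (ha0 : 0 ≤ a) (ha1 : a ≤ 1) :
    -(Real.log 2 + 1 + Real.log (m + 1)) ≤
      (m + 1 : ℝ) * ∫ s in (0:ℝ)..1, s ^ m * Real.log |s - a| := by
  set b : ℝ := a ^ (m + 1) with hb
  have hb0 : 0 ≤ b := by positivity
  have hb1 : b ≤ 1 := pow_le_one₀ ha0 ha1
  have hm : (0 : ℝ) < m + 1 := by positivity
  -- pointwise inequality
  have hpt : ∀ s ∈ Icc (0:ℝ) 1,
      s ^ m * (Real.log |s ^ (m + 1) - b| - Real.log (m + 1)) ≤ s ^ m * Real.log |s - a| := by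
    intro s hs
    apply mul_le_mul_of_nonneg_left _ (pow_nonneg hs.1 _)
    rcases eq_or_ne s a with rfl | hne
    · simp only [sub_self, abs_zero, Real.log_zero, zero_sub, Left.neg_nonpos_iff, hb]
      exact Real.log_nonneg (by linarith)
    · have h2 : 0 < |s - a| := abs_pos.mpr (sub_ne_zero.mpr hne)
      have h1 : |s ^ (m + 1) - b| ≤ (m + 1) * |s - a| := by
        have h := abs_pow_sub_pow_le (a := s) (b := a) (n := m + 1)
        have hmax : max |s| |a| ≤ 1 := by
          apply max_le
          · rw [abs_of_nonneg hs.1]; exact hs.2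
          · rw [abs_of_nonneg ha0]; exact ha1
        have hmax0 : 0 ≤ max |s| |a| := le_max_of_le_left (abs_nonneg s)
        calc |s ^ (m + 1) - b| ≤ |s - a| * ↑(m + 1) * max |s| |a| ^ (m + 1 - 1) := h
          _ ≤ |s - a| * ↑(m + 1) * 1 := by
              gcongr
              exact pow_le_one₀ hmax0 hmax
          _ = (m + 1) * |s - a| := by push_cast; ring
      have h3 : 0 < |s ^ (m + 1) - b| := by
        rw [abs_pos, sub_ne_zero, hb]
        intro h
        exact hne ((pow_left_inj₀ hs.1 ha0 (Nat.succ_ne_zero m)).mp h)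
      calc Real.log |s ^ (m + 1) - b| - Real.log (m + 1)
          ≤ Real.log ((m + 1) * |s - a|) - Real.log (m + 1) := by
            gcongr
        _ = Real.log |s - a| := by
            rw [Real.log_mul hm.ne' h2.ne']; ring
  -- integrability
  have hI1 : IntervalIntegrable (fun s : ℝ => s ^ m * Real.log |s - a|) volume 0 1 := by
    have hmer : MeromorphicOn (fun s : ℝ => s - a) (Set.uIcc 0 1) :=
      (analyticOnNhd_id.sub analyticOnNhd_const).meromorphicOn
    have h' : IntervalIntegrable (fun s : ℝ => Real.log |s - a|) volume 0 1 :=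
      hmer.intervalIntegrable_log.congr_ae
        (Filter.Eventually.of_forall (fun s => by simp [Function.comp, Real.log_abs]))
    exact h'.continuousOn_mul (by fun_prop)
  have hI2 : IntervalIntegrable
      (fun s : ℝ => s ^ m * (Real.log |s ^ (m + 1) - b| - Real.log (m + 1))) volume 0 1 := by
    have hmer : MeromorphicOn (fun s : ℝ => s ^ (m + 1) - b) (Set.uIcc 0 1) :=
      ((analyticOnNhd_id.pow (m + 1)).sub analyticOnNhd_const).meromorphicOn
    have h' : IntervalIntegrable (fun s : ℝ => Real.log |s ^ (m + 1) - b|) volume 0 1 :=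
      hmer.intervalIntegrable_log.congr_ae
        (Filter.Eventually.of_forall (fun s => by simp [Function.comp, Real.log_abs]))
    exact (h'.sub intervalIntegrable_const).continuousOn_mul (by fun_prop)
  have hmono := intervalIntegral.integral_mono_on zero_le_one hI2 hI1 hpt
  -- change of variables u = s^(m+1)
  have hcv : ∫ s in (0:ℝ)..1, s ^ m * Real.log |s ^ (m + 1) - b|
      = (1 / (m + 1 : ℝ)) * ∫ u in (0:ℝ)..1, Real.log |u - b| := by
    have key := integral_Icc_deriv_smul_of_deriv_nonneg (f := fun s : ℝ => s ^ (m + 1))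
      (f' := fun s : ℝ => (m + 1 : ℝ) * s ^ m) (g := fun u : ℝ => Real.log |u - b|)
      (a := 0) (b := 1) (by fun_prop)
      (fun x _ => by simpa using hasDerivAt_pow (m + 1) x)
      (fun x hx => by have := hx.1.le; positivity) zero_le_one
    rw [one_pow, zero_pow (Nat.succ_ne_zero m)] at key
    simp only [smul_eq_mul] at key
    rw [integral_Icc_eq_integral_Ioc, integral_Icc_eq_integral_Ioc,
      ← intervalIntegral.integral_of_le zero_le_one,
      ← intervalIntegral.integral_of_le zero_le_one] at key
    rw [← key, ← intervalIntegral.integral_const_mul]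
    congr 1
    funext s
    field_simp
  have hconst : ∫ s in (0:ℝ)..1, s ^ m * Real.log (m + 1) = Real.log (m + 1) / (m + 1) := by
    rw [intervalIntegral.integral_mul_const, integral_pow]
    simp
    field_simp
  have hsplit : ∫ s in (0:ℝ)..1, s ^ m * (Real.log |s ^ (m + 1) - b| - Real.log (m + 1))
      = (∫ s in (0:ℝ)..1, s ^ m * Real.log |s ^ (m + 1) - b|)
        - ∫ s in (0:ℝ)..1, s ^ m * Real.log (m + 1) := by
    have hI4 : IntervalIntegrable (fun s : ℝ => s ^ m * Real.log (m + 1)) volume 0 1 :=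
      (by fun_prop : Continuous fun s : ℝ => s ^ m * Real.log (m + 1)).intervalIntegrable _ _
    have hI3 : IntervalIntegrable (fun s : ℝ => s ^ m * Real.log |s ^ (m + 1) - b|)
        volume 0 1 :=
      (hI2.add hI4).congr_ae (Filter.Eventually.of_forall (fun s => by ring))
    rw [← intervalIntegral.integral_sub hI3 hI4]
    congr 1; funext s; ring
  rw [hsplit, hcv, hconst, integral_log_abs_sub] at hmono
  have hent := entropy_bound b
  have : (m + 1 : ℝ) * ((1 / (m + 1 : ℝ)) * (b * Real.log b + (1 - b) * Real.log (1 - b) - 1)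
      - Real.log (m + 1) / (m + 1))
      = (b * Real.log b + (1 - b) * Real.log (1 - b) - 1) - Real.log (m + 1) := by
    field_simp
  calc -(Real.log 2 + 1 + Real.log (m + 1))
      ≤ (b * Real.log b + (1 - b) * Real.log (1 - b) - 1) - Real.log (m + 1) := by linarith
    _ = (m + 1 : ℝ) * ((1 / (m + 1 : ℝ)) * (b * Real.log b + (1 - b) * Real.log (1 - b) - 1)
      - Real.log (m + 1) / (m + 1)) := this.symm
    _ ≤ (m + 1 : ℝ) * ∫ s in (0:ℝ)..1, s ^ m * Real.log |s - a| := by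
        gcongr

/-- `‖s - ζ‖² = (s - Re ζ)² + (Im ζ)²` for real `s`. [folklore] -/
private theorem normSq_real_sub (s : ℝ) (ζ : ℂ) :
    ‖(s : ℂ) - ζ‖ ^ 2 = (s - ζ.re) ^ 2 + ζ.im ^ 2 := by
  rw [Complex.sq_norm, Complex.normSq_apply]
  simp
  ring

/-- Interval integrability of the root factor `s ↦ s^m (log ‖s - ζ‖ - log ‖ζ‖)`.
[folklore] -/
private theorem root_factor_integrable (m : ℕ) (ζ : ℂ) (a b : ℝ) :
    IntervalIntegrable
      (fun s : ℝ => s ^ m * (Real.log ‖(s : ℂ) - ζ‖ - Real.log ‖ζ‖)) volume a b := by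
  have hmer : MeromorphicOn (fun s : ℝ => (s : ℂ) - ζ) (Set.uIcc a b) := by
    apply AnalyticOnNhd.meromorphicOn
    have h1 : AnalyticOnNhd ℝ (fun s : ℝ => (s : ℂ)) (Set.uIcc a b) :=
      Complex.ofRealCLM.analyticOnNhd _
    exact h1.sub analyticOnNhd_const
  have h' : IntervalIntegrable (fun s : ℝ => Real.log ‖(s : ℂ) - ζ‖) volume a b :=
    hmer.intervalIntegrable_log_norm
  exact (h'.sub intervalIntegrable_const).continuousOn_mul (by fun_prop)

/-- The root-factor bound (the mechanism of the proof of Carbery–Wright's Lemma 1, p. 237,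
one complex root at a time, here for the weight `(m+1) s^m ds`): for `ζ ≠ 0`,
`(m+1) ∫₀¹ s^m (log ‖s - ζ‖ - log ‖ζ‖) ds ≥ -(log 2 + 1 + log (m+1))`. [folklore] -/
private theorem root_factor_bound (m : ℕ) {ζ : ℂ} (hζ : ζ ≠ 0) :
    -(Real.log 2 + 1 + Real.log (m + 1)) ≤
      (m + 1 : ℝ) *
        ∫ s in (0:ℝ)..1, s ^ m * (Real.log ‖(s : ℂ) - ζ‖ - Real.log ‖ζ‖) := by
  set x := ζ.re with hx
  set y := ζ.im with hy
  set N := ‖ζ‖ ^ 2 with hN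
  have hNxy : N = x ^ 2 + y ^ 2 := by
    rw [hN, Complex.sq_norm, Complex.normSq_apply]; ring
  have hnormpos : 0 < ‖ζ‖ := norm_pos_iff.mpr hζ
  have hNpos : 0 < N := by positivity
  -- Step 1: a point `a' ∈ [0,1]` with `log |s - a'| ≤ log ‖s - ζ‖ - log ‖ζ‖`
  -- off `s = a'`.
  obtain ⟨a', ha'0, ha'1, hpt⟩ : ∃ a' : ℝ, 0 ≤ a' ∧ a' ≤ 1 ∧
      ∀ s ∈ Icc (0:ℝ) 1, s ≠ a' →
        Real.log |s - a'| ≤ Real.log ‖(s : ℂ) - ζ‖ - Real.log ‖ζ‖ := by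
    by_cases hcase : x ≤ N
    · refine ⟨1, zero_le_one, le_rfl, fun s hs hs1 => ?_⟩
      have hs1' : s < 1 := lt_of_le_of_ne hs.2 hs1
      have hkey : ‖ζ‖ * (1 - s) ≤ ‖(s : ℂ) - ζ‖ := by
        rw [← sq_le_sq₀ (by nlinarith [hs.2]) (norm_nonneg _), normSq_real_sub, mul_pow, ← hN,
          ← hx, ← hy]
        have hx2 : x ^ 2 ≤ N := by rw [hNxy]; nlinarith
        have hs0 : 0 ≤ s := hs.1
        have hs1 : s ≤ 1 := hs.2
        have hdecomp : (s - x) ^ 2 + y ^ 2 - N * (1 - s) ^ 2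
            = s * (2 - s) * (N - x) + s ^ 2 * (1 - x) := by
          rw [hNxy]; ring
        rcases le_or_gt x 1 with hx1 | hx1
        · have e1 : 0 ≤ s * (2 - s) * (N - x) :=
            mul_nonneg (mul_nonneg hs0 (by linarith)) (sub_nonneg.mpr hcase)
          have e2 : 0 ≤ s ^ 2 * (1 - x) := mul_nonneg (sq_nonneg s) (sub_nonneg.mpr hx1)
          linarith
        · have e1 : 0 ≤ s * (1 - s) * (N - x) :=
            mul_nonneg (mul_nonneg hs0 (sub_nonneg.mpr hs1)) (sub_nonneg.mpr hcase)
          have e2 : 0 ≤ s * (x - 1) * (x - s) :=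
            mul_nonneg (mul_nonneg hs0 (by linarith)) (by linarith)
          have e3 : x * (x - 1) ≤ N - x := by nlinarith [hx2]
          have h4 : s * (x * (x - 1)) ≤ s * (N - x) := mul_le_mul_of_nonneg_left e3 hs0
          nlinarith [e1, e2, h4, hdecomp]
      have hpos : 0 < ‖ζ‖ * (1 - s) := mul_pos hnormpos (by linarith)
      have := Real.log_le_log hpos hkey
      rw [Real.log_mul hnormpos.ne' (by linarith)] at this
      rw [abs_sub_comm, abs_of_nonneg (by linarith)]
      linarith
    · push Not at hcase
      have hxpos : 0 < x := lt_of_le_of_lt hNpos.le hcase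
      refine ⟨N / x, by positivity, (div_le_one hxpos).mpr hcase.le, fun s hs hsa => ?_⟩
      have hkey : ‖ζ‖ * |s - N / x| ≤ ‖(s : ℂ) - ζ‖ := by
        rw [← sq_le_sq₀ (by positivity) (norm_nonneg _), normSq_real_sub, mul_pow, sq_abs,
          ← hN, ← hx, ← hy]
        have h1 : x ^ 2 * (s - N / x) ^ 2 ≤ N * ((s - x) ^ 2 + y ^ 2) := by
          have : N * ((s - x) ^ 2 + y ^ 2) - x ^ 2 * (s - N / x) ^ 2 = s ^ 2 * y ^ 2 := by
            rw [hNxy]; field_simp; ring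
          nlinarith [sq_nonneg (s * y)]
        have h2 : N ^ 2 * (s - N / x) ^ 2 ≤ x ^ 2 * (s - N / x) ^ 2 := by
          apply mul_le_mul_of_nonneg_right _ (sq_nonneg _)
          exact pow_le_pow_left₀ hNpos.le hcase.le 2
        have h3 : N * (N * (s - N / x) ^ 2) ≤ N * ((s - x) ^ 2 + y ^ 2) := by nlinarith
        exact le_of_mul_le_mul_left h3 hNpos
      have habs : 0 < |s - N / x| := abs_pos.mpr (sub_ne_zero.mpr hsa)
      have hpos : 0 < ‖ζ‖ * |s - N / x| := mul_pos hnormpos habs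
      have := Real.log_le_log hpos hkey
      rw [Real.log_mul hnormpos.ne' habs.ne'] at this
      linarith
  -- Step 2: integrate (the exceptional point `a'` is Lebesgue-null).
  have hI1 : IntervalIntegrable (fun s : ℝ => s ^ m * Real.log |s - a'|) volume 0 1 := by
    have hmer : MeromorphicOn (fun s : ℝ => s - a') (Set.uIcc 0 1) :=
      (analyticOnNhd_id.sub analyticOnNhd_const).meromorphicOn
    have h' : IntervalIntegrable (fun s : ℝ => Real.log |s - a'|) volume 0 1 :=
      hmer.intervalIntegrable_log.congr_ae
        (Filter.Eventually.of_forall (fun s => by simp [Function.comp, Real.log_abs]))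
    exact h'.continuousOn_mul (by fun_prop)
  have hI2 := root_factor_integrable m ζ 0 1
  have hae : ∀ᵐ s : ℝ, s ≠ a' := by
    rw [ae_iff]
    simp
  have hle : (fun s : ℝ => s ^ m * Real.log |s - a'|) ≤ᵐ[volume.restrict (Icc (0:ℝ) 1)]
      (fun s : ℝ => s ^ m * (Real.log ‖(s : ℂ) - ζ‖ - Real.log ‖ζ‖)) := by
    rw [Filter.EventuallyLE, ae_restrict_iff' measurableSet_Icc]
    filter_upwards [hae] with s hs hsI
    exact mul_le_mul_of_nonneg_left (hpt s hsI hs) (pow_nonneg hsI.1 _)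
  have hmono := intervalIntegral.integral_mono_ae_restrict zero_le_one hI1 hI2 hle
  have hk := kernel_bound m ha'0 ha'1
  have hm : (0 : ℝ) < m + 1 := by positivity
  nlinarith

/-- Sum of root factors over a multiset of nonzero complex roots. [folklore] -/
private theorem multiset_root_bound (m : ℕ) (S : Multiset ℂ) (hS : ∀ ζ ∈ S, ζ ≠ 0) :
    IntervalIntegrable (fun s : ℝ => s ^ m *
      (S.map fun ζ => Real.log ‖(s : ℂ) - ζ‖ - Real.log ‖ζ‖).sum) volume 0 1 ∧
    -((Multiset.card S : ℝ) * (Real.log 2 + 1 + Real.log (m + 1))) ≤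
      (m + 1 : ℝ) * ∫ s in (0:ℝ)..1, s ^ m *
        (S.map fun ζ => Real.log ‖(s : ℂ) - ζ‖ - Real.log ‖ζ‖).sum := by
  induction S using Multiset.induction_on with
  | empty => simp
  | cons ζ S ih =>
    have hζ : ζ ≠ 0 := hS ζ (Multiset.mem_cons_self ζ S)
    have hS' : ∀ ζ' ∈ S, ζ' ≠ 0 := fun ζ' h => hS ζ' (Multiset.mem_cons_of_mem h)
    obtain ⟨ihI, ihB⟩ := ih hS'
    have hI2 := root_factor_integrable m ζ 0 1
    have hB2 := root_factor_bound m hζ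
    simp only [Multiset.map_cons, Multiset.sum_cons, Multiset.card_cons]
    have hfun : (fun s : ℝ => s ^ m * ((Real.log ‖(s : ℂ) - ζ‖ - Real.log ‖ζ‖) +
        (S.map fun ζ => Real.log ‖(s : ℂ) - ζ‖ - Real.log ‖ζ‖).sum)) =
        (fun s : ℝ => s ^ m * (Real.log ‖(s : ℂ) - ζ‖ - Real.log ‖ζ‖) +
          s ^ m * (S.map fun ζ => Real.log ‖(s : ℂ) - ζ‖ - Real.log ‖ζ‖).sum) := by
      funext s; ring
    rw [hfun]
    refine ⟨hI2.add ihI, ?_⟩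
    rw [intervalIntegral.integral_add hI2 ihI]
    push_cast
    nlinarith

open Polynomial in
/-- The one-dimensional lemma (a weighted `L⁰`–`L^∞` variant of Carbery–Wright's Lemma 1,
proved the same way, p. 237: factor `q` over `ℂ` and sum `root_factor_bound` over the roots):
for a real polynomial `q` with `q(0) ≠ 0`,
`(m+1) ∫₀¹ s^m (log |q s| - log |q 0|) ds ≥ -(natDegree q) · (log 2 + 1 + log (m+1))`.
[folklore] -/
private theorem poly_bound (m : ℕ) (q : ℝ[X]) (hq0 : q.eval 0 ≠ 0) :
    -((q.natDegree : ℝ) * (Real.log 2 + 1 + Real.log (m + 1))) ≤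
      (m + 1 : ℝ) * ∫ s in (0:ℝ)..1, s ^ m * (Real.log |q.eval s| - Real.log |q.eval 0|) := by
  have hq : q ≠ 0 := fun h => hq0 (by simp [h])
  set Q : ℂ[X] := q.map Complex.ofRealHom with hQdef
  have hinj : Function.Injective Complex.ofRealHom := Complex.ofRealHom.injective
  have hQne : Q ≠ 0 := (Polynomial.map_ne_zero_iff hinj).mpr hq
  have hQeval : ∀ s : ℝ, Q.eval (s : ℂ) = ((q.eval s : ℝ) : ℂ) := by
    intro s
    have := Polynomial.eval_map Complex.ofRealHom (Complex.ofRealHom s) (p := q)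
    rw [Polynomial.eval₂_at_apply] at this
    simpa using this
  have hsplit : Q.Splits := IsAlgClosed.splits Q
  have hlc : Q.leadingCoeff ≠ 0 := Polynomial.leadingCoeff_ne_zero.mpr hQne
  have hcard : Multiset.card Q.roots = q.natDegree :=
    IsAlgClosed.card_roots_map_eq_natDegree_of_injective q hinj
  have hmemroots : ∀ ζ ∈ Q.roots, Q.eval ζ = 0 := fun ζ hζ =>
    (Polynomial.mem_roots hQne).mp hζ
  have hroots0 : ∀ ζ ∈ Q.roots, ζ ≠ 0 := by
    intro ζ hζ h0
    have h := hmemroots ζ hζ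
    rw [h0] at h
    have h2 := hQeval 0
    push_cast at h2
    rw [h2] at h
    exact hq0 (by exact_mod_cast h)
  -- norm identity `|q s| = ‖lc‖ ∏ ‖s - ζ‖`
  have hnorm : ∀ s : ℝ, |q.eval s| =
      ‖Q.leadingCoeff‖ * (Q.roots.map fun ζ => ‖(s : ℂ) - ζ‖).prod := by
    intro s
    rw [← Real.norm_eq_abs, ← Complex.norm_real, ← hQeval s, hsplit.eval_eq_prod_roots,
      norm_mul]
    congr 1
    have := map_multiset_prod (normHom : ℂ →*₀ ℝ) (Q.roots.map fun ζ => (s : ℂ) - ζ)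
    simpa [Multiset.map_map, Function.comp_def] using this
  -- log identity off the (finitely many) real roots
  have hlog : ∀ s : ℝ, q.eval s ≠ 0 → Real.log |q.eval s| =
      Real.log ‖Q.leadingCoeff‖ +
        (Q.roots.map fun ζ => Real.log ‖(s : ℂ) - ζ‖).sum := by
    intro s hs
    have hfac : ∀ r ∈ (Q.roots.map fun ζ => ‖(s : ℂ) - ζ‖), r ≠ 0 := by
      intro r hr
      obtain ⟨ζ, hζ, rfl⟩ := Multiset.mem_map.mp hr
      intro h
      rw [norm_eq_zero, sub_eq_zero] at h
      have h2 := hmemroots ζ hζ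
      rw [← h, hQeval] at h2
      exact hs (by exact_mod_cast h2)
    have hprod : (Q.roots.map fun ζ => ‖(s : ℂ) - ζ‖).prod ≠ 0 := by
      rw [Ne, Multiset.prod_eq_zero_iff]
      exact fun h => hfac 0 h rfl
    rw [hnorm s, Real.log_mul (norm_ne_zero_iff.mpr hlc) hprod, Real.log_multiset_prod hfac,
      Multiset.map_map]
    rfl
  have hae : ∀ᵐ s : ℝ, q.eval s ≠ 0 := by
    rw [ae_iff]
    simp only [not_not]
    exact (Polynomial.finite_setOf_isRoot hq).measure_zero volume
  have hG : ∀ s : ℝ, q.eval s ≠ 0 → Real.log |q.eval s| - Real.log |q.eval 0| =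
      (Q.roots.map fun ζ => Real.log ‖(s : ℂ) - ζ‖ - Real.log ‖ζ‖).sum := by
    intro s hs
    rw [hlog s hs, hlog 0 hq0, Multiset.sum_map_sub]
    simp
  have hcongr : ∫ s in (0:ℝ)..1, s ^ m * (Real.log |q.eval s| - Real.log |q.eval 0|) =
      ∫ s in (0:ℝ)..1, s ^ m *
        (Q.roots.map fun ζ => Real.log ‖(s : ℂ) - ζ‖ - Real.log ‖ζ‖).sum := by
    apply intervalIntegral.integral_congr_ae
    filter_upwards [hae] with s hs _
    rw [hG s hs]
  rw [hcongr, ← hcard]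
  exact (multiset_root_bound m Q.roots hroots0).2

/-- `0 ≤ log 2 + 1 + log (m+1)`. [folklore] -/
private theorem c_nonneg (m : ℕ) : 0 ≤ Real.log 2 + 1 + Real.log (m + 1) := by
  have h1 : 0 ≤ Real.log 2 := Real.log_nonneg (by norm_num)
  have h2 : 0 ≤ Real.log (m + 1) := Real.log_nonneg (by norm_cast; omega)
  linarith

open Polynomial in
/-- Scaled one-dimensional lemma on `[0, ρ]` (substitution `r = ρ s` in `poly_bound`).
[folklore] -/
private theorem poly_bound_scaled (m : ℕ) (q : ℝ[X]) (hq0 : q.eval 0 ≠ 0) {ρ : ℝ}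
    (hρ : 0 < ρ) :
    -(ρ ^ (m + 1) * q.natDegree * (Real.log 2 + 1 + Real.log (m + 1))) ≤
      (m + 1 : ℝ) *
        ∫ r in (0:ℝ)..ρ, r ^ m * (Real.log |q.eval r| - Real.log |q.eval 0|) := by
  set q' : ℝ[X] := q.comp (C ρ * X) with hq'
  have hq'eval : ∀ s, q'.eval s = q.eval (ρ * s) := fun s => by simp [q']
  have hq'0 : q'.eval 0 = q.eval 0 := by simp [hq'eval]
  have hq'deg : q'.natDegree ≤ q.natDegree := by
    refine (Polynomial.natDegree_comp_le).trans ?_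
    calc q.natDegree * (C ρ * X).natDegree ≤ q.natDegree * 1 :=
          Nat.mul_le_mul_left _
            ((Polynomial.natDegree_C_mul_le ρ X).trans Polynomial.natDegree_X_le)
      _ = q.natDegree := mul_one _
  have hb := poly_bound m q' (by rwa [hq'0])
  rw [hq'0] at hb
  simp_rw [hq'eval] at hb
  -- substitution r = ρ s
  set f : ℝ → ℝ := fun r => r ^ m * (Real.log |q.eval r| - Real.log |q.eval 0|) with hf
  have hcomp := intervalIntegral.integral_comp_mul_left f hρ.ne' (a := 0) (b := 1)
  simp only [mul_zero, mul_one, smul_eq_mul] at hcomp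
  have hfun : (fun s : ℝ => s ^ m * (Real.log |q.eval (ρ * s)| - Real.log |q.eval 0|))
      = fun s => (ρ ^ m)⁻¹ * f (ρ * s) := by
    funext s
    simp only [hf, mul_pow]
    field_simp
  rw [hfun, intervalIntegral.integral_const_mul, hcomp] at hb
  have hc := c_nonneg m
  have hρm : 0 < ρ ^ (m + 1) := pow_pos hρ _
  have hid : (m + 1 : ℝ) * ((ρ ^ m)⁻¹ * (ρ⁻¹ * ∫ x in (0:ℝ)..ρ, f x))
      = (ρ ^ (m + 1))⁻¹ * ((m + 1 : ℝ) * ∫ x in (0:ℝ)..ρ, f x) := by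
    rw [pow_succ]
    field_simp
  rw [hid] at hb
  have hdeg : (q'.natDegree : ℝ) ≤ q.natDegree := by exact_mod_cast hq'deg
  have h1 : -(↑q.natDegree * (Real.log 2 + 1 + Real.log (↑m + 1)))
      ≤ (ρ ^ (m + 1))⁻¹ * ((m + 1 : ℝ) * ∫ x in (0:ℝ)..ρ, f x) := by
    refine le_trans ?_ hb
    have := mul_le_mul_of_nonneg_right hdeg hc
    linarith
  have h2 := mul_le_mul_of_nonneg_left h1 hρm.le
  rw [← mul_assoc, mul_inv_cancel₀ hρm.ne', one_mul] at h2
  linarith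

open Polynomial in
/-- Interval integrability of `log |q|` for a real polynomial `q` (meromorphic functions have
integrable `log`). [folklore] -/
private theorem intervalIntegrable_log_abs_poly (q : ℝ[X]) (a b : ℝ) :
    IntervalIntegrable (fun r : ℝ => Real.log |q.eval r|) volume a b := by
  have hmer : MeromorphicOn (fun r : ℝ => q.eval r) (Set.uIcc a b) :=
    ((AnalyticOnNhd.eval_polynomial (𝕜 := ℝ) q).mono (Set.subset_univ _)).meromorphicOn
  exact hmer.intervalIntegrable_log.congr_ae
    (Filter.Eventually.of_forall (fun s => by simp [Function.comp, Real.log_abs]))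

open Polynomial in
/-- The per-ray estimate.  `T` is the (closed, order-connected, bounded) set of parameters `r`
with `x₀ + r θ ∈ K`; on `T ∩ (0, ∞) = (0, ρ]`,
`∫ r^m (log M - log |q r|) ≤ d (log 2 + 1 + log (m+1)) ∫ r^m`. [folklore] -/
private theorem ray_bound {m d : ℕ} {q : ℝ[X]} (hqd : q.natDegree ≤ d) {M : ℝ} (hM : 0 < M)
    (hq0 : |q.eval 0| = M) {T : Set ℝ} (hTc : IsClosed T) (hTconn : T.OrdConnected)
    (hT0 : (0:ℝ) ∈ T) (hTbdd : BddAbove T) (hqM : ∀ r ∈ T, |q.eval r| ≤ M) :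
    ∫⁻ r in Ioi (0:ℝ), T.indicator
        (fun r => ENNReal.ofReal (r ^ m) * ENNReal.ofReal (Real.log M - Real.log |q.eval r|)) r
      ≤ ENNReal.ofReal (d * (Real.log 2 + 1 + Real.log (m + 1))) *
        ∫⁻ r in Ioi (0:ℝ), T.indicator (fun r => ENNReal.ofReal (r ^ m)) r := by
  set c : ℝ := Real.log 2 + 1 + Real.log (m + 1) with hcdef
  have hc : 0 ≤ c := c_nonneg m
  set ρ := sSup T with hρdef
  have hρT : ρ ∈ T := hTc.csSup_mem ⟨0, hT0⟩ hTbdd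
  have hle : ∀ r ∈ T, r ≤ ρ := fun r hr => le_csSup hTbdd hr
  have hρ0 : 0 ≤ ρ := hle 0 hT0
  have hIcc : Icc 0 ρ ⊆ T := hTconn.out hT0 hρT
  have hTI : T ∩ Ioi 0 = Ioc 0 ρ := by
    ext r
    constructor
    · rintro ⟨hT, h0⟩; exact ⟨h0, hle r hT⟩
    · rintro ⟨h0, hr⟩; exact ⟨hIcc ⟨h0.le, hr⟩, h0⟩
  have hTm : MeasurableSet T := hTc.measurableSet
  rw [lintegral_indicator hTm, lintegral_indicator hTm, Measure.restrict_restrict hTm, hTI]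
  -- right-hand side integral
  have hR : ∫⁻ r in Ioc 0 ρ, ENNReal.ofReal (r ^ m)
      = ENNReal.ofReal (ρ ^ (m + 1) / (m + 1)) := by
    rw [← ofReal_integral_eq_lintegral_ofReal]
    · rw [← intervalIntegral.integral_of_le hρ0, integral_pow]
      simp
    · exact (continuous_pow m).integrableOn_Ioc
    · rw [Filter.EventuallyLE, ae_restrict_iff' measurableSet_Ioc]
      exact Filter.Eventually.of_forall (fun r hr => pow_nonneg hr.1.le _)
  rw [hR]
  rcases hρ0.eq_or_lt with hρz | hρpos
  · rw [← hρz]; simp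
  -- `q` is nonzero, its real roots are Lebesgue-null
  have hq : q ≠ 0 := by
    rintro rfl; simp at hq0; exact hM.ne' hq0.symm
  have hae : ∀ᵐ r : ℝ, q.eval r ≠ 0 := by
    rw [ae_iff]
    simp only [not_not]
    exact (Polynomial.finite_setOf_isRoot hq).measure_zero volume
  set L : ℝ → ℝ := fun r => r ^ m * (Real.log M - Real.log |q.eval r|) with hL
  have hcongr : ∫⁻ r in Ioc 0 ρ, ENNReal.ofReal (r ^ m) *
      ENNReal.ofReal (Real.log M - Real.log |q.eval r|)
        = ∫⁻ r in Ioc 0 ρ, ENNReal.ofReal (L r) := by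
    apply setLIntegral_congr_fun measurableSet_Ioc
    intro r hr
    simp only [hL]
    rw [ENNReal.ofReal_mul (pow_nonneg hr.1.le _)]
  have hint : IntervalIntegrable L volume 0 ρ := by
    have := (intervalIntegrable_const (c := Real.log M)).sub
      (intervalIntegrable_log_abs_poly q 0 ρ)
    exact this.continuousOn_mul (by fun_prop)
  have hnn : 0 ≤ᵐ[volume.restrict (Ioc 0 ρ)] L := by
    rw [Filter.EventuallyLE, ae_restrict_iff' measurableSet_Ioc]
    filter_upwards [hae] with r hr hrI
    have hrT : r ∈ T := hIcc ⟨hrI.1.le, hrI.2⟩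
    have h1 : Real.log |q.eval r| ≤ Real.log M :=
      Real.log_le_log (abs_pos.mpr hr) (hqM r hrT)
    exact mul_nonneg (pow_nonneg hrI.1.le _) (by linarith)
  rw [hcongr, ← ofReal_integral_eq_lintegral_ofReal hint.1 hnn,
    ← intervalIntegral.integral_of_le hρpos.le,
    ← ENNReal.ofReal_mul (by positivity)]
  apply ENNReal.ofReal_le_ofReal
  -- the real inequality
  have hb := poly_bound_scaled m q (by rw [← abs_ne_zero, hq0]; exact hM.ne') hρpos
  rw [hq0] at hb
  have hLint : ∫ r in (0:ℝ)..ρ, L r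
      = -∫ r in (0:ℝ)..ρ, r ^ m * (Real.log |q.eval r| - Real.log M) := by
    rw [← intervalIntegral.integral_neg]
    congr 1; funext r; simp only [hL]; ring
  rw [hLint]
  have hm : (0:ℝ) < m + 1 := by positivity
  have hdeg : (q.natDegree : ℝ) ≤ d := by exact_mod_cast hqd
  have hρm : 0 < ρ ^ (m + 1) := pow_pos hρpos _
  have h3 : ρ ^ (m + 1) * ↑q.natDegree * c ≤ ρ ^ (m + 1) * d * c := by
    gcongr
  set I := ∫ r in (0:ℝ)..ρ, r ^ m * (Real.log |q.eval r| - Real.log M) with hI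
  have h4 : -I * (m + 1) ≤ ρ ^ (m + 1) * d * c := by linarith
  calc -I = (-I * (m + 1)) / (m + 1) := by field_simp
    _ ≤ (ρ ^ (m + 1) * d * c) / (m + 1) := div_le_div_of_nonneg_right h4 hm.le
    _ = ↑d * c * (ρ ^ (m + 1) / (↑m + 1)) := by ring

end GeometricMeanOneDim

section GeometricMeanAssembly

/-- Polar-coordinate formula for the lower Lebesgue integral on a finite-dimensional real normed
space (any norm): `∫⁻ G dμ = ∫_{sphere} ∫_{r > 0} r^(dim-1) G(r θ) dr dσ(θ)`,
`σ = μ.toSphere`, from Mathlib's `measurePreserving_homeomorphUnitSphereProd`. [folklore] -/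
theorem lintegral_eq_lintegral_sphere_Ioi {E : Type*} [NormedAddCommGroup E]
    [NormedSpace ℝ E] [MeasurableSpace E] [BorelSpace E] [FiniteDimensional ℝ E] [Nontrivial E]
    (μ : Measure E) [μ.IsAddHaarMeasure] (G : E → ℝ≥0∞) (hG : Measurable G) :
    ∫⁻ x, G x ∂μ = ∫⁻ θ : sphere (0 : E) 1, (∫⁻ r in Ioi (0 : ℝ),
      ENNReal.ofReal (r ^ (Module.finrank ℝ E - 1)) * G (r • (θ : E))) ∂μ.toSphere := by
  have hmeas : Measurable (fun y : sphere (0 : E) 1 × Ioi (0 : ℝ) =>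
      G ((homeomorphUnitSphereProd E).symm y)) :=
    hG.comp (continuous_subtype_val.comp (homeomorphUnitSphereProd E).symm.continuous).measurable
  calc ∫⁻ x, G x ∂μ = ∫⁻ x : ({(0 : E)}ᶜ : Set E), G x ∂(μ.comap (↑)) := by
        rw [lintegral_subtype_comap (measurableSet_singleton 0).compl, restrict_compl_singleton]
    _ = ∫⁻ y, G ((homeomorphUnitSphereProd E).symm y)
          ∂(μ.toSphere.prod (Measure.volumeIoiPow (Module.finrank ℝ E - 1))) := by
        rw [← (μ.measurePreserving_homeomorphUnitSphereProd).lintegral_comp_emb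
          (Homeomorph.measurableEmbedding _)]
        simp only [Homeomorph.symm_apply_apply]
    _ = ∫⁻ θ : sphere (0 : E) 1, ∫⁻ r : Ioi (0 : ℝ),
          G ((homeomorphUnitSphereProd E).symm (θ, r))
            ∂(Measure.volumeIoiPow (Module.finrank ℝ E - 1)) ∂μ.toSphere := by
        rw [lintegral_prod _ hmeas.aemeasurable]
    _ = _ := by
        apply lintegral_congr
        intro θ
        simp only [homeomorphUnitSphereProd_symm_apply_coe]
        have hg : Measurable (fun r : Ioi (0 : ℝ) => G ((r : ℝ) • (θ : E))) :=
          hG.comp (by fun_prop)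
        rw [Measure.volumeIoiPow, lintegral_withDensity_eq_lintegral_mul _ (by fun_prop) hg]
        rw [← lintegral_subtype_comap measurableSet_Ioi
          (f := fun r : ℝ =>
            ENNReal.ofReal (r ^ (Module.finrank ℝ E - 1)) * G (r • (θ : E)))]
        rfl

/-- The main estimate (Brudnyi–Ganzburg cone argument): if `x₀ ∈ K` maximises `|p|` on the
compact convex `K ⊂ ℝ^{m+1}`, `M = |p x₀| > 0`, then
`∫⁻_K (log M - log |p|) ≤ d · (log 2 + 1 + log (m+1)) · vol K`. [folklore] -/
private theorem main_lintegral_bound {m d : ℕ} (p : MvPolynomial (Fin (m + 1)) ℝ)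
    (hp : p.totalDegree ≤ d) (K : Set (Fin (m + 1) → ℝ)) (hKc : IsCompact K)
    (hKconv : Convex ℝ K) (x₀ : Fin (m + 1) → ℝ) (hx₀ : x₀ ∈ K) {M : ℝ} (hM : 0 < M)
    (hMx₀ : |MvPolynomial.eval x₀ p| = M) (hmax : ∀ x ∈ K, |MvPolynomial.eval x p| ≤ M) :
    ∫⁻ x in K, ENNReal.ofReal (Real.log M - Real.log |MvPolynomial.eval x p|)
      ≤ ENNReal.ofReal (d * (Real.log 2 + 1 + Real.log (m + 1))) * volume K := by
  set c : ℝ := Real.log 2 + 1 + Real.log (m + 1) with hcdef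
  have hc : 0 ≤ c := c_nonneg m
  set F : (Fin (m + 1) → ℝ) → ℝ≥0∞ :=
    fun x => ENNReal.ofReal (Real.log M - Real.log |MvPolynomial.eval x p|) with hF
  have hFm : Measurable F := by
    apply Measurable.ennreal_ofReal
    exact measurable_const.sub (Real.measurable_log.comp
      (continuous_abs.measurable.comp (MvPolynomial.continuous_eval p).measurable))
  have hKm : MeasurableSet K := hKc.isClosed.measurableSet
  set Kx : Set (Fin (m + 1) → ℝ) := (fun y => x₀ + y) ⁻¹' K with hKx
  have hKxm : MeasurableSet Kx := hKm.preimage (measurable_const_add x₀)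
  set G : (Fin (m + 1) → ℝ) → ℝ≥0∞ := Kx.indicator (fun y => F (x₀ + y)) with hG
  set G₁ : (Fin (m + 1) → ℝ) → ℝ≥0∞ := Kx.indicator (fun _ => 1) with hG₁
  have hGm : Measurable G := (hFm.comp (measurable_const_add x₀)).indicator hKxm
  have hG₁m : Measurable G₁ := measurable_const.indicator hKxm
  -- Step 1: translate by `x₀`
  have h1 : ∫⁻ x in K, F x = ∫⁻ y, G y := by
    calc ∫⁻ x in K, F x = ∫⁻ x, K.indicator F x := (lintegral_indicator hKm _).symm
      _ = ∫⁻ y, K.indicator F (x₀ + y) :=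
          (lintegral_add_left_eq_self (K.indicator F) x₀).symm
      _ = ∫⁻ y, G y := by
          congr 1
  have h1' : ∫⁻ y, G₁ y = volume K := by
    rw [hG₁, lintegral_indicator hKxm, setLIntegral_one, hKx, measure_preimage_add]
  -- Step 2: polar coordinates
  have hpol := lintegral_eq_lintegral_sphere_Ioi volume G hGm
  have hpol₁ := lintegral_eq_lintegral_sphere_Ioi volume G₁ hG₁m
  simp only [Module.finrank_fin_fun, Nat.add_sub_cancel] at hpol hpol₁
  -- Step 3: the per-ray bound
  have hray : ∀ θ : sphere (0 : Fin (m + 1) → ℝ) 1,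
      ∫⁻ r in Ioi (0:ℝ), ENNReal.ofReal (r ^ m) * G (r • (θ : Fin (m + 1) → ℝ))
        ≤ ENNReal.ofReal (d * c) *
          ∫⁻ r in Ioi (0:ℝ),
            ENNReal.ofReal (r ^ m) * G₁ (r • (θ : Fin (m + 1) → ℝ)) := by
    intro θ
    obtain ⟨q, hqd, hqeval⟩ := exists_linePoly p x₀ (θ : Fin (m + 1) → ℝ)
    set T : Set ℝ := {r : ℝ | x₀ + r • (θ : Fin (m + 1) → ℝ) ∈ K} with hT
    have hGT : ∀ r : ℝ, ENNReal.ofReal (r ^ m) * G (r • (θ : Fin (m + 1) → ℝ)) =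
        T.indicator (fun r => ENNReal.ofReal (r ^ m) *
          ENNReal.ofReal (Real.log M - Real.log |q.eval r|)) r := by
      intro r
      by_cases h : x₀ + r • (θ : Fin (m + 1) → ℝ) ∈ K
      · have hT' : r ∈ T := h
        have hKx' : r • (θ : Fin (m + 1) → ℝ) ∈ Kx := h
        simp only [hG, hF, Set.indicator_of_mem hKx', Set.indicator_of_mem hT', hqeval]
      · have hT' : r ∉ T := h
        have hKx' : r • (θ : Fin (m + 1) → ℝ) ∉ Kx := h
        simp only [hG, Set.indicator_of_notMem hKx', Set.indicator_of_notMem hT', mul_zero]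
    have hG₁T : ∀ r : ℝ, ENNReal.ofReal (r ^ m) * G₁ (r • (θ : Fin (m + 1) → ℝ)) =
        T.indicator (fun r => ENNReal.ofReal (r ^ m)) r := by
      intro r
      by_cases h : x₀ + r • (θ : Fin (m + 1) → ℝ) ∈ K
      · have hT' : r ∈ T := h
        have hKx' : r • (θ : Fin (m + 1) → ℝ) ∈ Kx := h
        simp only [hG₁, Set.indicator_of_mem hKx', Set.indicator_of_mem hT', mul_one]
      · have hT' : r ∉ T := h
        have hKx' : r • (θ : Fin (m + 1) → ℝ) ∉ Kx := h
        simp only [hG₁, Set.indicator_of_notMem hKx', Set.indicator_of_notMem hT', mul_zero]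
    simp_rw [hGT, hG₁T]
    -- hypotheses of `ray_bound`
    have hθ : ‖(θ : Fin (m + 1) → ℝ)‖ = 1 := norm_eq_of_mem_sphere θ
    have hcont : Continuous (fun r : ℝ => x₀ + r • (θ : Fin (m + 1) → ℝ)) := by fun_prop
    have hTc : IsClosed T := hKc.isClosed.preimage hcont
    have hTconv : Convex ℝ T := by
      intro a ha b hb u v hu hv huv
      show x₀ + (u • a + v • b) • (θ : Fin (m + 1) → ℝ) ∈ K
      have hid : x₀ + (u • a + v • b) • (θ : Fin (m + 1) → ℝ)
          = u • (x₀ + a • (θ : Fin (m + 1) → ℝ))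
            + v • (x₀ + b • (θ : Fin (m + 1) → ℝ)) := by
        ext i
        simp only [Pi.add_apply, Pi.smul_apply, smul_eq_mul]
        linear_combination (-(x₀ i)) * huv
      rw [hid]
      exact hKconv ha hb hu hv huv
    have hT0 : (0:ℝ) ∈ T := by simp [hT, hx₀]
    obtain ⟨C, hC⟩ := isBounded_iff_forall_norm_le.mp hKc.isBounded
    have hTbdd : BddAbove T := by
      refine ⟨C + ‖x₀‖, fun r hr => ?_⟩
      have h1 : ‖r • (θ : Fin (m + 1) → ℝ)‖ ≤ C + ‖x₀‖ := by
        calc ‖r • (θ : Fin (m + 1) → ℝ)‖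
            = ‖(x₀ + r • (θ : Fin (m + 1) → ℝ)) - x₀‖ := by rw [add_sub_cancel_left]
          _ ≤ ‖x₀ + r • (θ : Fin (m + 1) → ℝ)‖ + ‖x₀‖ := norm_sub_le _ _
          _ ≤ C + ‖x₀‖ := by gcongr; exact hC _ hr
      rw [norm_smul, hθ, mul_one, Real.norm_eq_abs] at h1
      exact (le_abs_self r).trans h1
    have hq0 : |q.eval 0| = M := by rw [hqeval]; simp [hMx₀]
    have hqM : ∀ r ∈ T, |q.eval r| ≤ M := fun r hr => by rw [hqeval]; exact hmax _ hr
    exact ray_bound (hqd.trans hp) hM hq0 hTc hTconv.ordConnected hT0 hTbdd hqM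
  -- Step 4: combine
  calc ∫⁻ x in K, F x = ∫⁻ y, G y := h1
    _ = _ := hpol
    _ ≤ ∫⁻ θ : sphere (0 : Fin (m + 1) → ℝ) 1, (ENNReal.ofReal (d * c) *
          ∫⁻ r in Ioi (0:ℝ), ENNReal.ofReal (r ^ m) * G₁ (r • (θ : Fin (m + 1) → ℝ)))
          ∂(volume.toSphere) := lintegral_mono hray
    _ = ENNReal.ofReal (d * c) * ∫⁻ θ : sphere (0 : Fin (m + 1) → ℝ) 1,
          (∫⁻ r in Ioi (0:ℝ),
            ENNReal.ofReal (r ^ m) * G₁ (r • (θ : Fin (m + 1) → ℝ)))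
          ∂(volume.toSphere) := lintegral_const_mul' _ _ ENNReal.ofReal_ne_top
    _ = ENNReal.ofReal (d * c) * ∫⁻ y, G₁ y := by rw [hpol₁]
    _ = ENNReal.ofReal (d * c) * volume K := by rw [h1']

/-- **Carbery–Wright, Theorem 1 at `r = 0`, `q = ∞` (scalar case), discharged** with the
absolute constant `C = 2e`: for `n, d ≥ 1`, a real polynomial `p` of degree `≤ d` on `ℝⁿ`
and a convex body `K` of volume `1` with `sup_K |p| > 0`, `log |p| ∈ L¹(K)` and
`(sup_K |p|)^{1/d} ≤ 2e · n · exp((1/d) ∫_K log |p|)`.  Proof: `main_lintegral_bound`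
(polar coordinates about a maximiser + the one-dimensional root-factorisation lemma), then
`∫_K log |p| ≥ log M - d (log 2 + 1 + log n)` and exponentiation.
[cite: CarberyWright2001, Thm 1 (r = 0, q = ∞)] -/
theorem supLeGeometricMean_holds : supLeGeometricMean := by
  refine ⟨2 * Real.exp 1, by positivity, ?_⟩
  intro n d hn hd p hp K hKc hKconv hKint hKvol hsup
  obtain ⟨m, rfl⟩ : ∃ m, n = m + 1 := ⟨n - 1, by omega⟩
  -- the maximiser
  have hfc : Continuous (fun x : Fin (m + 1) → ℝ => |MvPolynomial.eval x p|) :=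
    continuous_abs.comp (MvPolynomial.continuous_eval p)
  have hKne : K.Nonempty := hKint.mono interior_subset
  obtain ⟨x₀, hx₀, hmax⟩ := hKc.exists_isMaxOn hKne hfc.continuousOn
  have hsSup : sSup ((fun x : Fin (m + 1) → ℝ => |MvPolynomial.eval x p|) '' K)
      = |MvPolynomial.eval x₀ p| :=
    IsGreatest.csSup_eq ⟨mem_image_of_mem _ hx₀, by rintro _ ⟨x, hx, rfl⟩; exact hmax hx⟩
  rw [hsSup] at hsup ⊢
  set M := |MvPolynomial.eval x₀ p| with hM
  set c := Real.log 2 + 1 + Real.log (m + 1) with hc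
  have hcnn : 0 ≤ c := c_nonneg m
  have hmax' : ∀ x ∈ K, |MvPolynomial.eval x p| ≤ M := fun x hx => hmax hx
  have hlint := main_lintegral_bound p hp K hKc hKconv x₀ hx₀ hsup rfl hmax'
  rw [hKvol, mul_one] at hlint
  have hKm : MeasurableSet K := hKc.isClosed.measurableSet
  have hKfin : volume K ≠ ∞ := by rw [hKvol]; exact ENNReal.one_ne_top
  -- integrability of `h = log M - log |p|` on `K`
  set h : (Fin (m + 1) → ℝ) → ℝ := fun x => Real.log M - Real.log |MvPolynomial.eval x p|
    with hh
  have hhm : Measurable h :=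
    measurable_const.sub (Real.measurable_log.comp (continuous_abs.measurable.comp
      (MvPolynomial.continuous_eval p).measurable))
  have hlower : ∀ x ∈ K, -|Real.log M| ≤ h x := by
    intro x hx
    by_cases h0 : MvPolynomial.eval x p = 0
    · simp only [hh, h0, abs_zero, Real.log_zero, sub_zero]
      exact neg_abs_le _
    · have h1 : Real.log |MvPolynomial.eval x p| ≤ Real.log M :=
        Real.log_le_log (abs_pos.mpr h0) (hmax' x hx)
      have h2 : 0 ≤ h x := by simp only [hh]; linarith
      linarith [abs_nonneg (Real.log M)]
  have hnorm_le : ∀ x ∈ K, ‖h x‖ ≤ h x + 2 * |Real.log M| := by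
    intro x hx
    rw [Real.norm_eq_abs]
    have := hlower x hx
    rcases le_or_gt 0 (h x) with h0 | h0
    · rw [abs_of_nonneg h0]; linarith [abs_nonneg (Real.log M)]
    · rw [abs_of_neg h0]; linarith
  set g : (Fin (m + 1) → ℝ) → ℝ := fun x => h x + 2 * |Real.log M| with hg
  have hgm : Measurable g := hhm.add measurable_const
  have hg_nn : 0 ≤ᵐ[volume.restrict K] g := by
    rw [Filter.EventuallyLE, ae_restrict_iff' hKm]
    refine Filter.Eventually.of_forall (fun x hx => ?_)
    have := hlower x hx
    simp only [hg, Pi.zero_apply]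
    linarith [abs_nonneg (Real.log M)]
  have hg_int : IntegrableOn g K volume := by
    refine ⟨hgm.aestronglyMeasurable, ?_⟩
    rw [hasFiniteIntegral_iff_ofReal hg_nn]
    calc ∫⁻ x in K, ENNReal.ofReal (g x)
        ≤ ∫⁻ x in K, ENNReal.ofReal (h x) + ENNReal.ofReal (2 * |Real.log M|) :=
          lintegral_mono (fun x => ENNReal.ofReal_add_le)
      _ = (∫⁻ x in K, ENNReal.ofReal (h x))
            + ∫⁻ x in K, ENNReal.ofReal (2 * |Real.log M|) :=
          lintegral_add_right _ measurable_const
      _ < ∞ := by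
          apply ENNReal.add_lt_top.mpr
          constructor
          · exact lt_of_le_of_lt hlint ENNReal.ofReal_lt_top
          · rw [setLIntegral_const, hKvol, mul_one]; exact ENNReal.ofReal_lt_top
  have hh_int : IntegrableOn h K volume := by
    refine hg_int.mono' hhm.aestronglyMeasurable ?_
    rw [ae_restrict_iff' hKm]
    exact Filter.Eventually.of_forall hnorm_le
  have hconst_int : IntegrableOn (fun _ : Fin (m + 1) → ℝ => Real.log M) K volume :=
    integrableOn_const hKfin
  have hfun : (fun x => Real.log |MvPolynomial.eval x p|) = fun x => Real.log M - h x := by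
    funext x; simp only [hh]; ring
  have hlog_int : IntegrableOn (fun x => Real.log |MvPolynomial.eval x p|) K volume := by
    rw [hfun]
    exact hconst_int.sub hh_int
  refine ⟨hlog_int, ?_⟩
  -- the integral bound `∫_K h ≤ d c`
  have hint_le : ∫ x in K, h x ≤ d * c := by
    have h1 := integral_eq_lintegral_pos_part_sub_lintegral_neg_part hh_int
    have h2 : (∫⁻ x in K, ENNReal.ofReal (h x)).toReal ≤ d * c := by
      have := ENNReal.toReal_mono ENNReal.ofReal_ne_top hlint
      rwa [ENNReal.toReal_ofReal (by positivity)] at this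
    have h3 : 0 ≤ (∫⁻ x in K, ENNReal.ofReal (-h x)).toReal := ENNReal.toReal_nonneg
    rw [h1]
    linarith
  have hlogint : ∫ x in K, Real.log |MvPolynomial.eval x p| = Real.log M - ∫ x in K, h x := by
    rw [hfun, integral_sub hconst_int hh_int, setIntegral_const]
    simp [Measure.real, hKvol]
  -- exponentiate
  have hd0 : (0:ℝ) < d := by exact_mod_cast hd
  have key : (1 / d : ℝ) * Real.log M - c
      ≤ (1 / d : ℝ) * ∫ x in K, Real.log |MvPolynomial.eval x p| := by
    rw [hlogint, mul_sub]
    have h1 : (1 / d : ℝ) * ∫ x in K, h x ≤ (1 / d) * (d * c) :=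
      mul_le_mul_of_nonneg_left hint_le (by positivity)
    have h2 : (1 / d : ℝ) * (d * c) = c := by field_simp
    linarith
  calc M ^ ((1:ℝ) / d) = Real.exp (Real.log M * (1 / d)) := Real.rpow_def_of_pos hsup _
    _ = Real.exp ((1 / d) * Real.log M - c) * Real.exp c := by
        rw [← Real.exp_add]; ring_nf
    _ ≤ Real.exp ((1 / d) * ∫ x in K, Real.log |MvPolynomial.eval x p|) * Real.exp c := by
        gcongr
    _ = 2 * Real.exp 1 * ((m + 1 : ℕ) : ℝ) *
        Real.exp ((1 / d) * ∫ x in K, Real.log |MvPolynomial.eval x p|) := by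
        rw [hc, Real.exp_add, Real.exp_add, Real.exp_log two_pos,
          Real.exp_log (by positivity)]
        push_cast
        ring

end GeometricMeanAssembly

end Literature.Analysis.Approximation.CarberyWright
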